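import Literature.ModelTheory.ExponentialFields.Wilkie1996AbsoluteInequality
import Literature.ModelTheory.ExponentialFields.Wilkie1996SmoothFunctions
import Literature.ModelTheory.ExponentialFields.Wilkie1996SmoothnessS2
import Literature.ModelTheory.ExponentialFields.TarskiQE
import Literature.ModelTheory.ExponentialFields.ModelTheoryPredsProofs
import Mathlib.FieldTheory.AlgebraicClosure
import Mathlib.Algebra.Ring.Subring.Order
import HarnessLib

/-!
# Wilkie 1996, §10 / den Besten, Theorem 7.1.22: the surjectivity step, and Wilkie's theorem from the First Main Theorem and `S₁`

Topic `Literature/ModelTheory/ExponentialFields`.  `Wilkie1996AbsoluteInequality.lean` reduces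
the boundedness leaf `Wilkie1996_expPolynomialPoints_bounded` of Wilkie's theorem (and with it
`wilkie_isModelComplete`, `Wilkie1996_realExp_modelsExistentiallyClosed`,
`Wilkie1996_expPolynomial_transfer`, `wilkie_isOMinimal`) to three hypotheses: the First Main
Theorem `hMC : rexpTheory.IsModelComplete`, the polynomial bounds `hS1` (condition `S₁` for
`T_e` in all models) and `hsurj`, **the surjectivity step** of the printed proof of
M. den Besten, *Wilkie's Theorem and the Uniform Real Schanuel Conjecture* (MSc thesis, Utrecht
2016), Theorem 7.1.22, pp. 86–89 (A. J. Wilkie, J. Amer. Math. Soc. 9 (1996), §10):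

> "it would suffice to show that the map `ν_K : k* → V(K)` is surjective … We may therefore
> assume that `d ∈ I` and `d > 0`. Let `f : Kʳ → K` be a `k`-definable function such that
> `f(c₁, …, c_r) = d` … We can now apply property `S₂` … By transfer of the Extreme Value
> Theorem to `K`, `h` must attain a minimum on the set `([0,1] ∖ (d/2, 2d/3)) × A`, as this set
> is closed, bounded and definable. Let `γ` be this minimum and note that `γ > 0` … consider the
> Taylor expansion of degree `λ` of the function `F : K^{r+1+m} → K`, at the point `ω⃗` … we can
> express the conjunction of (42), (43) and (44) as `ψ(d, β₁, …, β_m)`, where `ψ` … is an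
> `L`-formula with parameters in `k*`. Since both `K` and `k*` are real closed fields, `k*` is an
> elementary substructure of `K`, when regarded as `L`-structures, since the theory of real
> closed fields admits quantifier elimination. This means that there must be elements
> `α, β'₁, …, β'_m ∈ k*` such that `ψ(α, β'₁, …, β'_m)` holds … using the triangle inequality
> … `|F(c₁, …, c_r, α, β'₁, …, β'_m)| < |c₁|^{N'}`. But this is exactly what we needed to
> achieve."

This file **proves `hsurj`** (`SurjectivityStep.surjectivity_step`, with exactly the hypothesis
list of `AbsoluteInequality.absolute_of_surjectivity`) following the printed proof, with the
smooth functions of `T_e` provided by `Wilkie1996SmoothFunctions.lean` (graphs, extreme values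
and Taylor approximation of `z ↦ P(z, e(z), ẽ(z))` in every model of `T_exp`) and the smoothness
condition `S₂` with bounded witnesses by `Wilkie1996SmoothnessS2.lean`:

* `SurjectivityStep.isRealClosed`, `isRealClosed_algebraicClosure`,
  `exists_polynomial_of_mem_algebraicClosure`, `exists_realize_of_isRealClosed` — the models of
  `T_exp` are real closed, `k* := k(C̄)^{alg} ∩ M` is a real closed subfield whose elements are
  roots of polynomials over `k[C̄]`, and (model completeness of `RCF`, `TarskiQE.lean`) solvable
  `L_or`-formulas with parameters in `k*` are solvable in `k*`;
* `SurjectivityStep.inI_add`, `inI_mul_inR`, `lt_of_inI_of_mem`, `exists_pow_lt_of_inI`, … —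
  the arithmetic of the ring `R_a` and its archimedean maximal ideal `I_a`;
* `SurjectivityStep.exists_smooth_data` — Steps 2–4 of the printed proof: the `k`-definable
  function with value `d` at `C̄`, its presentation `F(γ̄; C̄, d; β) = 0` by `S₂` with `|βⱼ| < 1`,
  `β ∈ Kᵐ` (elementarity of the definably closed `K`), and `F(γ̄; C̄, x; ȳ) = 0 ⇒ x = d`;
* `SurjectivityStep.exists_isMinOn_box_mem`, `exists_taylor_mem` — minimizers and Taylor data
  inside an elementary substructure (`K`, resp. `k`);
* `SurjectivityStep.exists_mem_algebraicClosure_near` — the transfer of (45)–(47) to `k*`;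
* `SurjectivityStep.endgame` — Steps 5–10: `β⁰ ∈ kᵐ` by the splitting, the margin
  `θ = c₁^{2L}`, the minimum `γ₀ > 0` of `|F|` on the boxes `[0, d/2] × A` and `[2d, 1] × A`
  (attained at points of `K`), `η = c₁^{2N'} < γ₀`, `t₀ ∈ I ∩ K` dominating the distance to
  `ω = (0̄, 0, β⁰)`, the order `λ` with `t₀^λ < η`, Taylor data `r₀, B, c ∈ k`, and the transfer;
* `SurjectivityStep.surjectivity_step` — **`hsurj`** (after replacing `d` by `|d|`);
* `RealExpModel.exists_isVUnit_prod_zpow_of_S1` — **the absolute valuation inequality for `T_e`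
  (den Besten, Theorem 7.1.22) from `hMC` and `hS1` alone**;
* `Wilkie1996_expPolynomialPoints_bounded_of_S1`, `wilkie_isModelComplete_of_S1`,
  `Wilkie1996_realExp_modelsExistentiallyClosed_of_S1`, `Wilkie1996_expPolynomial_transfer_of_S1`,
  `wilkie_isOMinimal_of_S1` — the leaf, **Wilkie's theorem** and its corollaries from the First
  Main Theorem and `S₁` for `T_e`.

Deviations from the printed proof: the excluded interval is `(d/2, 2d)` (the printed
`(d/2, 2d/3)` does not contain `d`); the `c̄`-coordinates are pinned inside the boxes instead of
being substituted; the box `A = [-(1 - θ), 1 - θ]ᵐ` has the explicit margin `θ = c₁^{2L}`; the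
Taylor estimate (40) is used with a radius `r₀ ∈ k` and (47) with an existentially quantified
`t` (so no roots `c₁^{N'/(λ+1)}` are needed); `k*` is the relative algebraic closure of `k(C̄)`
in `M` and its elementarity for `L_or`-formulas is model completeness of `RCF`.

Nothing here is a named fact; no definition is introduced.  What remains hypothetical in
Wilkie's theorem after this file are exactly `hMC` (the First Main Theorem, Wilkie 1996 §§2–8)
and `hS1` (polynomial bounds for `T_e`, den Besten Theorem 7.2.1 via van den Dries 1986).

## References

* M. den Besten, *Wilkie's Theorem and the Uniform Real Schanuel Conjecture*, MSc thesis, Utrecht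
  (2016): Theorem 7.1.22 (pp. 84–89), Lemma 2.3.4, Theorem 7.2.1, §6.2. [DenBesten2016]
* A. J. Wilkie, *Model completeness results for expansions of the ordered field of real numbers by
  restricted Pfaffian functions and the exponential function*, J. Amer. Math. Soc. 9 (1996),
  1051–1094, §10 and §§9–11. [WilkieJAMS1996]
-/

noncomputable section

open Set FirstOrder FirstOrder.Language FirstOrder.Language.Structure

namespace Literature.ModelTheory.ExponentialFields

namespace SurjectivityStep

open RealExpModel

variable (M : Language.Theory.ModelType.{0, 0, 0} realExpTheory)

/-! ### The models of `T_exp` are real closed; relative algebraic closures -/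

/-- **A model of `T_exp` is a real closed field** (its ordered-field reduct is a model of `Th(ℝ̄)`,
hence of `RCF`). [cite: DenBesten2016, Lemma 2.3.4] -/
theorem isRealClosed : IsRealClosed M := by
  letI := FirstOrder.Ring.compatibleRingOfRing (M : Type)
  haveI : (M : Type) ⊨ Theory.RCF := by
    refine ⟨fun σ hσ => ?_⟩
    have hR : ℝ ⊨ σ := real_model_RCF.realize_of_mem σ hσ
    have hR' : ℝ ⊨ orderedRingHomOrderedExpRing.onSentence σ :=
      (LHom.realize_onSentence ℝ orderedRingHomOrderedExpRing σ).2 hR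
    have hM' : (M : Type) ⊨ orderedRingHomOrderedExpRing.onSentence σ :=
      RealExpModel.realize_sentence_of_real M hR'
    exact (LHom.realize_onSentence M orderedRingHomOrderedExpRing σ).1 hM'
  exact isRealClosed_of_model_RCF M

variable {M}

/-- **The relative algebraic closure of a subfield of a model of `T_exp` is real closed** (square
roots of non-negative algebraic elements and roots of odd-degree polynomials over it are
algebraic). [folklore] -/
theorem isRealClosed_algebraicClosure (F : Subfield M) : IsRealClosed (algebraicClosure F M) := by
  haveI : IsRealClosed M := isRealClosed M
  haveI : IsStrictOrderedRing (algebraicClosure F M) := Subring.toIsStrictOrderedRing _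
  refine IsRealClosed.of_linearOrderedField (fun {x} hx => ?_) (fun {f} hf => ?_)
  · -- square roots
    have hx' : (0 : M) ≤ x := hx
    obtain ⟨y, hy⟩ := RealExpModel.exists_mul_self_eq hx'
    have hyalg : IsAlgebraic F y := by
      refine IsAlgebraic.of_pow two_pos ?_
      rw [sq, hy]
      exact mem_algebraicClosure_iff.1 x.2
    refine ⟨⟨y, mem_algebraicClosure_iff.2 hyalg⟩, Subtype.ext ?_⟩
    show (x : M) = y * y
    rw [hy]
  · -- odd-degree polynomials
    set fM := f.map (algebraMap (algebraicClosure F M) M) with hfM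
    have hdeg : fM.natDegree = f.natDegree := Polynomial.natDegree_map _
    obtain ⟨z, hz⟩ := IsRealClosed.exists_isRoot_of_odd_natDegree (f := fM) (by rwa [hdeg])
    have hf0 : f ≠ 0 := by
      rintro rfl
      simp at hf
    have hz' : Polynomial.aeval z f = 0 := by
      rw [Polynomial.aeval_def, ← Polynomial.eval_map, ← hfM]
      exact hz
    have hzalg : IsAlgebraic (algebraicClosure F M) z := ⟨f, hf0, hz'⟩
    have hzF : IsAlgebraic F z := hzalg.restrictScalars F
    refine ⟨⟨z, mem_algebraicClosure_iff.2 hzF⟩, ?_⟩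
    apply (injective_iff_map_eq_zero (algebraMap (algebraicClosure F M) M)).1
      (FaithfulSMul.algebraMap_injective _ _)
    rw [← Polynomial.aeval_algebraMap_apply_eq_algebraMap_eval]
    exact hz'

/-- The elements of the relative algebraic closure of `k(C)` are roots of non-zero polynomials
with coefficients in the ring `k[C]` (clearing the denominators of a polynomial over the field
`k(C)`). [folklore] -/
theorem exists_polynomial_of_mem_algebraicClosure (S : Set M) {α : M}
    (hα : α ∈ algebraicClosure (Subfield.closure S) M) :
    ∃ p : Polynomial M, p ≠ 0 ∧ (∀ n, p.coeff n ∈ Subring.closure S) ∧ p.eval α = 0 := by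
  classical
  obtain ⟨q, hq0, hqα⟩ := mem_algebraicClosure_iff.1 hα
  set p₀ : Polynomial M := q.map (algebraMap (Subfield.closure S) M) with hp₀
  have hp₀0 : p₀ ≠ 0 := by
    rw [hp₀, Ne, Polynomial.map_eq_zero_iff (FaithfulSMul.algebraMap_injective _ _)]
    exact hq0
  have hp₀α : p₀.eval α = 0 := by
    rw [hp₀, Polynomial.eval_map, ← Polynomial.aeval_def]
    exact hqα
  have hcoeff : ∀ n, p₀.coeff n ∈ Subfield.closure S := fun n => by
    rw [hp₀, Polynomial.coeff_map]
    exact (q.coeff n).2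
  -- denominators
  have hfrac : ∀ n, ∃ y ∈ Subring.closure S, ∃ z ∈ Subring.closure S, y / z = p₀.coeff n :=
    fun n => Subfield.mem_closure_iff.1 (hcoeff n)
  choose y hy z hz hyz using hfrac
  have hz0 : ∀ n ∈ p₀.support, z n ≠ 0 := by
    intro n hn h0
    have h := hyz n
    rw [h0, div_zero] at h
    exact (Polynomial.mem_support_iff.1 hn) h.symm
  set D : M := ∏ n ∈ p₀.support, z n with hD
  have hDmem : D ∈ Subring.closure S := Subring.prod_mem _ fun n _ => hz n
  have hD0 : D ≠ 0 := Finset.prod_ne_zero_iff.2 hz0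
  refine ⟨Polynomial.C D * p₀, mul_ne_zero (by simpa using hD0) hp₀0, fun n => ?_, ?_⟩
  · rw [Polynomial.coeff_C_mul]
    by_cases hn : n ∈ p₀.support
    · rw [← hyz n, hD, ← Finset.mul_prod_erase _ _ hn]
      have h : z n * (∏ n' ∈ p₀.support.erase n, z n') * (y n / z n) =
          (∏ n' ∈ p₀.support.erase n, z n') * y n := by
        rw [div_eq_mul_inv, show z n * (∏ n' ∈ p₀.support.erase n, z n') * (y n * (z n)⁻¹) =
          (∏ n' ∈ p₀.support.erase n, z n') * y n * (z n * (z n)⁻¹) by ring,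
          mul_inv_cancel₀ (hz0 n hn), mul_one]
      rw [h]
      exact Subring.mul_mem _ (Subring.prod_mem _ fun n' _ => hz n') (hy n)
    · rw [Polynomial.notMem_support_iff.1 hn, mul_zero]
      exact Subring.zero_mem _
  · rw [Polynomial.eval_mul, Polynomial.eval_C, hp₀α, mul_zero]

/-! ### Transfer of existential statements to real closed subfields (Tarski) -/

/-- **Real closed intermediate fields are existentially closed in `M`** (model completeness of
`RCF`, from Tarski's quantifier elimination `RCFQE.hasQE_RCF` and
`Theory.HasQE.isModelComplete_holds`; den Besten 2016, p. 88: "`k*` is an elementary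
substructure of `K`, when regarded as `L`-structures, since the theory of real closed fields
admits quantifier elimination"): a formula of the language of ordered rings with parameters in a
real closed intermediate field `S ⊆ M` which has a solution in `M` has one in `S`.
[cite: DenBesten2016, Theorem 7.1.22 (p. 88)] -/
theorem exists_realize_of_isRealClosed {F : Type} [Field F] [Algebra F M]
    (S : IntermediateField F M) [IsRealClosed S] {n l : ℕ}
    (ψ : Language.orderedRing.Formula (Fin n ⊕ Fin l)) (par : Fin n → S)
    (hex : ∃ w : Fin l → M, ψ.Realize (Sum.elim (fun i => (par i : M)) w)) :
    ∃ w : Fin l → S, ψ.Realize (Sum.elim (fun i => (par i : M)) (fun j => (w j : M))) := by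
  classical
  haveI : IsRealClosed M := isRealClosed M
  letI := FirstOrder.Ring.compatibleRingOfRing (M : Type)
  letI := FirstOrder.Ring.compatibleRingOfRing (S : Type)
  haveI : IsStrictOrderedRing S := Subring.toIsStrictOrderedRing _
  haveI hSM : (S : Type) ⊨ Theory.RCF := model_RCF_of_isRealClosed S
  haveI hMM : (M : Type) ⊨ Theory.RCF := model_RCF_of_isRealClosed M
  let MS : Language.Theory.ModelType Theory.RCF := Language.Theory.ModelType.of Theory.RCF S
  let MM : Language.Theory.ModelType Theory.RCF := Language.Theory.ModelType.of Theory.RCF M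
  -- the inclusion is an embedding of ordered-ring structures
  let f : S ↪[Language.orderedRing] M :=
    { toFun := fun s => (s : M)
      inj' := Subtype.val_injective
      map_fun' := by
        intro m g x
        cases g <;> simp
      map_rel' := by
        intro m r x
        cases r
        simp only [Language.orderedRing.relMap_le, Function.comp_apply]
        exact Subtype.coe_le_coe }
  have hf : ∀ s : S, f s = (s : M) := fun s => rfl
  have hMC : Theory.RCF.IsModelComplete :=
    Language.Theory.HasQE.isModelComplete_holds RCFQE.hasQE_RCF
  -- `∃ w ψ` goes down
  have h1 : (Formula.iExs (Fin l) ψ).Realize (M := MM) ((f : S → M) ∘ par) := by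
    have h : (Formula.iExs (Fin l) ψ).Realize (M := M) ((f : S → M) ∘ par) := by
      rw [Formula.realize_iExs]
      obtain ⟨w, hw⟩ := hex
      exact ⟨w, hw⟩
    exact h
  have h2 : (Formula.iExs (Fin l) ψ).Realize (M := MS) par := (hMC MS MM f n _ par).1 h1
  have h2' : (Formula.iExs (Fin l) ψ).Realize (M := S) par := h2
  rw [Formula.realize_iExs] at h2'
  obtain ⟨w, hw⟩ := h2'
  refine ⟨w, ?_⟩
  -- and `ψ` goes up again
  have hdown : (ψ.relabel ⇑finSumFinEquiv).Realize (M := S) (Sum.elim par w ∘ ⇑finSumFinEquiv.symm) := by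
    rw [Formula.realize_relabel]
    have hc : (Sum.elim par w ∘ ⇑(finSumFinEquiv (m := n) (n := l)).symm) ∘ ⇑finSumFinEquiv =
        Sum.elim par w := by
      funext x; simp
    rw [hc]
    exact hw
  have h3 : (ψ.relabel ⇑finSumFinEquiv).Realize (M := MM)
      ((f : S → M) ∘ (Sum.elim par w ∘ ⇑finSumFinEquiv.symm)) :=
    (hMC MS MM f (n + l) (ψ.relabel ⇑finSumFinEquiv) (Sum.elim par w ∘ ⇑finSumFinEquiv.symm)).2 hdown
  have h3' : (ψ.relabel ⇑finSumFinEquiv).Realize (M := M)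
      ((f : S → M) ∘ (Sum.elim par w ∘ ⇑finSumFinEquiv.symm)) := h3
  rw [Formula.realize_relabel] at h3'
  have hc : ((f : S → M) ∘ (Sum.elim par w ∘ ⇑(finSumFinEquiv (m := n) (n := l)).symm)) ∘
      ⇑finSumFinEquiv = Sum.elim (fun i => (par i : M)) (fun j => (w j : M)) := by
    funext x
    simp only [Function.comp_apply, Equiv.symm_apply_apply]
    rcases x with i | j <;> rfl
  rw [hc] at h3'
  exact h3'

/-! ### The ring `R` and the ideal `I` of an infinitesimal scale `a` -/

section Scale

variable {a : M}

/-- `a < 1`. [folklore] -/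
theorem scale_lt_one (hainf : ∀ n : ℕ, (n : M) * a < 1) : a < 1 := by simpa using hainf 1

/-- `I ⊆ R`: `|b|^{q+1} ≤ a` for some `q` implies `|b|^q a < 1` for all `q`. [folklore] -/
theorem inR_of_inI (ha : 0 < a) (hainf : ∀ n : ℕ, (n : M) * a < 1) {b : M}
    (hb : ∃ q : ℕ, |b| ^ (q + 1) ≤ a) (q : ℕ) : |b| ^ q * a < 1 := by
  have ha1 : a < 1 := scale_lt_one hainf
  have ha0 : 0 ≤ a := ha.le
  obtain ⟨q₀, hq₀⟩ := hb
  have hb1 : |b| < 1 := by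
    by_contra h
    push Not at h
    have : (1 : M) ≤ |b| ^ (q₀ + 1) := one_le_pow₀ h
    linarith
  have hbq : |b| ^ q ≤ 1 := pow_le_one₀ (abs_nonneg _) hb1.le
  calc |b| ^ q * a ≤ 1 * a := by gcongr
    _ = a := one_mul a
    _ < 1 := ha1

/-- `I · R ⊆ I`. [folklore] -/
theorem inI_mul_inR (ha : 0 < a) {η ρ : M} (hη : ∃ q : ℕ, |η| ^ (q + 1) ≤ a)
    (hρ : ∀ q : ℕ, |ρ| ^ q * a < 1) :
    ∃ q : ℕ, |η * ρ| ^ (q + 1) ≤ a := by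
  obtain ⟨q, hq⟩ := hη
  refine ⟨2 * q + 1, ?_⟩
  have h : |η * ρ| ^ (2 * q + 1 + 1) = (|η| ^ (q + 1)) ^ 2 * |ρ| ^ (2 * q + 2) := by
    rw [abs_mul, mul_pow, ← pow_mul]
    ring_nf
  rw [h]
  have h3 : 0 ≤ |ρ| ^ (2 * q + 2) := pow_nonneg (abs_nonneg _) _
  calc (|η| ^ (q + 1)) ^ 2 * |ρ| ^ (2 * q + 2) ≤ a ^ 2 * |ρ| ^ (2 * q + 2) := by gcongr
    _ = a * (|ρ| ^ (2 * q + 2) * a) := by ring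
    _ ≤ a * 1 := by gcongr; exact (hρ _).le
    _ = a := mul_one a

/-- `I` is downward closed in absolute value. [folklore] -/
theorem inI_of_abs_le {x y : M} (hxy : |x| ≤ |y|) (hy : ∃ q : ℕ, |y| ^ (q + 1) ≤ a) :
    ∃ q : ℕ, |x| ^ (q + 1) ≤ a := by
  obtain ⟨q, hq⟩ := hy
  exact ⟨q, (pow_le_pow_left₀ (abs_nonneg _) hxy _).trans hq⟩

/-- Natural numbers lie in `R`. [folklore] -/
theorem inR_natCast (hainf : ∀ n : ℕ, (n : M) * a < 1) (n q : ℕ) : |(n : M)| ^ q * a < 1 := by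
  rw [Nat.abs_cast, ← Nat.cast_pow]
  exact hainf _

/-- `0 ∈ I`. [folklore] -/
theorem inI_zero (ha : 0 < a) : ∃ q : ℕ, |(0 : M)| ^ (q + 1) ≤ a := ⟨0, by simp [ha.le]⟩

/-- `I` is closed under addition. [folklore] -/
theorem inI_add (ha : 0 < a) (hainf : ∀ n : ℕ, (n : M) * a < 1) {b b' : M}
    (hb : ∃ q : ℕ, |b| ^ (q + 1) ≤ a) (hb' : ∃ q : ℕ, |b'| ^ (q + 1) ≤ a) :
    ∃ q : ℕ, |b + b'| ^ (q + 1) ≤ a := by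
  have hmax : ∃ q : ℕ, (abs (max |b| |b'|)) ^ (q + 1) ≤ a := by
    rcases le_total |b| |b'| with h | h
    · rw [max_eq_right h, abs_abs]; exact hb'
    · rw [max_eq_left h, abs_abs]; exact hb
  have h2 := inI_mul_inR ha hmax (inR_natCast hainf 2)
  refine inI_of_abs_le ?_ h2
  have hm : (0 : M) ≤ max |b| |b'| := le_max_of_le_left (abs_nonneg b)
  rw [abs_mul, abs_of_nonneg hm, Nat.abs_cast]
  calc |b + b'| ≤ |b| + |b'| := abs_add_le b b'
    _ ≤ max |b| |b'| * (2 : ℕ) := by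
      rw [Nat.cast_two, mul_two]
      exact add_le_add (le_max_left _ _) (le_max_right _ _)

/-- `I` is closed under finite sums. [folklore] -/
theorem inI_sum (ha : 0 < a) (hainf : ∀ n : ℕ, (n : M) * a < 1) {ι : Type*} (s : Finset ι)
    (f : ι → M) (hf : ∀ i ∈ s, ∃ q : ℕ, |f i| ^ (q + 1) ≤ a) :
    ∃ q : ℕ, |∑ i ∈ s, f i| ^ (q + 1) ≤ a := by
  classical
  induction s using Finset.induction_on with
  | empty => simpa using inI_zero ha
  | insert i s hi ih =>
    rw [Finset.sum_insert hi]
    exact inI_add ha hainf (hf i (Finset.mem_insert_self i s))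
      (ih fun j hj => hf j (Finset.mem_insert_of_mem hj))

/-- An element of `I` is smaller than every positive element of a subfield `k ⊆ R`
(`k ∩ I = {0}`). [folklore] -/
theorem lt_of_inI_of_mem (ha : 0 < a) (hainf : ∀ n : ℕ, (n : M) * a < 1) {k : Set M}
    (hkR : ∀ b ∈ k, ∀ q : ℕ, |b| ^ q * a < 1) (hkinv : ∀ b ∈ k, b⁻¹ ∈ k) {r₀ : M} (hr₀k : r₀ ∈ k)
    (hr₀ : 0 < r₀) {t : M} (ht : ∃ q : ℕ, |t| ^ (q + 1) ≤ a) : t < r₀ := by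
  have ha1 : a < 1 := scale_lt_one hainf
  by_contra hcon
  push Not at hcon
  have hr₀I : ∃ q : ℕ, |r₀| ^ (q + 1) ≤ a :=
    inI_of_abs_le (by rw [abs_of_pos hr₀]; exact hcon.trans (le_abs_self t)) ht
  obtain ⟨q, hq⟩ := inI_mul_inR ha hr₀I (hkR _ (hkinv _ hr₀k))
  rw [mul_inv_cancel₀ hr₀.ne', abs_one, one_pow] at hq
  exact not_lt.2 hq ha1

/-- **The archimedean property of `I ∩ K`**: a power of an element of `I` is below any given
positive element of `K` (den Besten 2016, p. 85: "its unique maximal ideal is Archimedean").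
[cite: DenBesten2016, Theorem 7.1.22 (p. 85)] -/
theorem exists_pow_lt_of_inI (hainf : ∀ n : ℕ, (n : M) * a < 1) {K : Set M}
    (hcoi : ∀ b ∈ K, 0 < b → ∃ q : ℕ, a ^ q < b) {x : M} (hxK : x ∈ K) (hx : 0 < x) {b : M}
    (hb : ∃ q : ℕ, |b| ^ (q + 1) ≤ a) : ∃ l : ℕ, 0 < l ∧ |b| ^ l < x := by
  have ha1 : a < 1 := scale_lt_one hainf
  obtain ⟨q', hq'⟩ := hb
  have hb1 : |b| < 1 := by
    by_contra h
    push Not at h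
    have : (1 : M) ≤ |b| ^ (q' + 1) := one_le_pow₀ h
    linarith
  obtain ⟨q, hq⟩ := hcoi x hxK hx
  cases q with
  | zero =>
    refine ⟨1, one_pos, ?_⟩
    rw [pow_one]
    rw [pow_zero] at hq
    exact hb1.trans hq
  | succ q =>
    refine ⟨(q' + 1) * (q + 1), Nat.mul_pos (Nat.succ_pos _) (Nat.succ_pos _), ?_⟩
    rw [pow_mul]
    calc (|b| ^ (q' + 1)) ^ (q + 1) ≤ a ^ (q + 1) := by gcongr
      _ < x := hq

end Scale

/-! ### From `d ∈ Dcl_e(k ∪ C)` to a smooth presentation with bounded witnesses in `K` -/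

section SmoothData

open SaturationStep SmoothFunctions SmoothnessS2

/-- **The smooth presentation of `d` over `k` and `C̄`** (den Besten 2016, p. 87: "Let
`f : Kʳ → K` be a `k`-definable function such that `f(c₁, …, c_r) = d` … We can now apply
property `S₂` … take `β₁, …, β_m ∈ K` such that … `F(c₁, …, c_r, d, β₁, …, β_m) = 0`"): for
`K, k` definably closed, `k ⊆ K`, `C̄ ∈ Kʳ` and `d ∈ K ∩ Dcl_e(k ∪ C̄)` there are parameters
`γ̄ ∈ k^{n₀}`, an integer polynomial `P` in the variables of `Wilkie1996SmoothFunctions.lean`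
(parameters `Fin n₀`, blocks `Fin r ⊕ Fin 1` and `Fin m`) and witnesses `β ∈ Kᵐ`, `|βⱼ| < 1`,
such that `F(γ̄; C̄, d; β) = 0` and `F(γ̄; C̄, x; ȳ) = 0` with `|yⱼ| < 1` forces `x = d`.
[cite: DenBesten2016, Theorem 7.1.22 (p. 87)] -/
theorem exists_smooth_data (hMC : rexpTheory.IsModelComplete) (K k : Set M)
    (hKcl : definableClosure Language.orderedERing K = K)
    (hkK : k ⊆ K) {r : ℕ} (C : Fin r → M) (hCK : ∀ i, C i ∈ K) (d : M) (hdK : d ∈ K)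
    (hdgen : d ∈ definableClosure Language.orderedERing (k ∪ Set.range C)) :
    ∃ (n₀ m : ℕ) (γ : Fin n₀ → M)
      (P : MvPolynomial ((Fin n₀ ⊕ ((Fin r ⊕ Fin 1) ⊕ Fin m)) ⊕
        (Fin n₀ ⊕ ((Fin r ⊕ Fin 1) ⊕ Fin m))) ℤ) (β : Fin m → M),
      (∀ i, γ i ∈ k) ∧ (∀ j, β j ∈ K ∧ |β j| < 1) ∧
      MvPolynomial.aeval (Sum.elim (Sum.elim γ (Sum.elim (Sum.elim C ![d]) β)) (Sum.elim (fun i => EFun.e (γ i)) (Sum.elim (fun i => EFun.e ((Sum.elim (Sum.elim C ![d]) β : (Fin r ⊕ Fin 1) ⊕ Fin m → M) (Sum.inl i))) (fun j => if (Sum.elim (Sum.elim C ![d]) β : (Fin r ⊕ Fin 1) ⊕ Fin m → M) (Sum.inr j) ^ 2 = 1 then 1 else EFun.e ((Sum.elim (Sum.elim C ![d]) β : (Fin r ⊕ Fin 1) ⊕ Fin m → M) (Sum.inr j) / (1 - (Sum.elim (Sum.elim C ![d]) β : (Fin r ⊕ Fin 1) ⊕ Fin m → M) (Sum.inr j) ^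 2)))))) P = 0 ∧
      ∀ (x : M) (y : Fin m → M), (∀ j, |y j| < 1) →
        MvPolynomial.aeval (Sum.elim (Sum.elim γ (Sum.elim (Sum.elim C ![x]) y)) (Sum.elim (fun i => EFun.e (γ i)) (Sum.elim (fun i => EFun.e ((Sum.elim (Sum.elim C ![x]) y : (Fin r ⊕ Fin 1) ⊕ Fin m → M) (Sum.inl i))) (fun j => if (Sum.elim (Sum.elim C ![x]) y : (Fin r ⊕ Fin 1) ⊕ Fin m → M) (Sum.inr j) ^ 2 = 1 then 1 else EFun.e ((Sum.elim (Sum.elim C ![x]) y : (Fin r ⊕ Fin 1) ⊕ Fin m → M) (Sum.inr j) / (1 - (Sum.elim (Sum.elim C ![x]) y : (Fin r ⊕ Fin 1) ⊕ Fin m → M) (Sum.inr j) ^ 2)))))) P = 0 → x = d := by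
  classical
  set φe : Language.orderedRing →ᴸ Language.orderedERing := LHom.sumInl with hφe
  have hO : Language.orderedERing.IsOMinimal M :=
    isOMinimal_orderedERing_of_rexp_isModelComplete hMC M
  -- parameters from `k`
  obtain ⟨A₀, hA₀sub, hA₀fin, hdA₀⟩ := exists_finite_mem_definableClosure hdgen
  obtain ⟨n₀, γe, hγe⟩ := (hA₀fin.inter_of_left k).fin_embedding
  set γ : Fin n₀ → M := fun i => γe i with hγ
  have hγk : ∀ i, γ i ∈ k := fun i => by
    have h : γe i ∈ A₀ ∩ k := by rw [← hγe]; exact Set.mem_range_self i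
    exact h.2
  have hdq : d ∈ definableClosure Language.orderedERing (Set.range (Sum.elim γ C)) := by
    refine definableClosure_mono ?_ hdA₀
    intro z hz
    rcases hA₀sub hz with hzk | hzC
    · have h : z ∈ Set.range γe := by rw [hγe]; exact ⟨hz, hzk⟩
      obtain ⟨i, rfl⟩ := h
      exact ⟨Sum.inl i, rfl⟩
    · obtain ⟨i, rfl⟩ := hzC
      exact ⟨Sum.inr i, rfl⟩
  obtain ⟨φd, hφd⟩ := exists_formula_of_mem_definableClosure_range hdq
  -- `S₂` with bounded witnesses, in `Fin N` variables
  let ε : (Fin n₀ ⊕ Fin r) ⊕ Fin 1 ≃ Fin (n₀ + r + 1) :=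
    (finSumFinEquiv.sumCongr (Equiv.refl (Fin 1))).trans finSumFinEquiv
  obtain ⟨m, P, hP⟩ := exists_bounded_presentation hMC (φd.relabel ⇑ε)
  -- renaming into the block variables
  let θ : (Fin (n₀ + r + 1) ⊕ Fin m) ≃ (Fin n₀ ⊕ ((Fin r ⊕ Fin 1) ⊕ Fin m)) :=
    (Equiv.sumCongr ε.symm (Equiv.refl (Fin m))).trans
      ((Equiv.sumCongr (Equiv.sumAssoc (Fin n₀) (Fin r) (Fin 1)) (Equiv.refl (Fin m))).trans
        (Equiv.sumAssoc (Fin n₀) (Fin r ⊕ Fin 1) (Fin m)))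
  let P' : MvPolynomial ((Fin n₀ ⊕ ((Fin r ⊕ Fin 1) ⊕ Fin m)) ⊕
      (Fin n₀ ⊕ ((Fin r ⊕ Fin 1) ⊕ Fin m))) ℤ := MvPolynomial.rename (Sum.map θ θ) P
  -- the evaluation points: block form (for `P'`) and `Fin N` form (for `P`)
  let pt : ((Fin r ⊕ Fin 1) ⊕ Fin m → M) →
      (Fin n₀ ⊕ ((Fin r ⊕ Fin 1) ⊕ Fin m)) ⊕ (Fin n₀ ⊕ ((Fin r ⊕ Fin 1) ⊕ Fin m)) → M :=
    fun p => Sum.elim (Sum.elim γ p) (Sum.elim (fun i => EFun.e (γ i))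
      (Sum.elim (fun i => EFun.e (p (Sum.inl i)))
        (fun j => if p (Sum.inr j) ^ 2 = 1 then 1 else EFun.e (p (Sum.inr j) / (1 - p (Sum.inr j) ^ 2)))))
  let pt2 : (Fin r → M) → M → (Fin m → M) →
      (Fin (n₀ + r + 1) ⊕ Fin m) ⊕ (Fin (n₀ + r + 1) ⊕ Fin m) → M :=
    fun cs x y => Sum.elim (Sum.elim ((Sum.elim (Sum.elim γ cs) ![x]) ∘ ⇑ε.symm) y)
      (Sum.elim (fun i => EFun.e (((Sum.elim (Sum.elim γ cs) ![x]) ∘ ⇑ε.symm) i))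
        (fun j => if y j ^ 2 = 1 then 1 else EFun.e (y j / (1 - y j ^ 2))))
  have hpt : ∀ (cs : Fin r → M) (x : M) (y : Fin m → M),
      pt (Sum.elim (Sum.elim cs ![x]) y) ∘ Sum.map θ θ = pt2 cs x y := by
    intro cs x y
    funext v
    rcases v with (i | j) | (i | j)
    · show pt (Sum.elim (Sum.elim cs ![x]) y) (Sum.inl (θ (Sum.inl i))) = _
      rcases hu : ε.symm i with (i₀ | i') | k₀
      · simp [pt, pt2, θ, hu]
      · simp [pt, pt2, θ, hu]
      · simp [pt, pt2, θ, hu]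
    · show pt (Sum.elim (Sum.elim cs ![x]) y) (Sum.inl (θ (Sum.inr j))) = _
      simp [pt, pt2, θ]
    · show pt (Sum.elim (Sum.elim cs ![x]) y) (Sum.inr (θ (Sum.inl i))) = _
      rcases hu : ε.symm i with (i₀ | i') | k₀
      · simp [pt, pt2, θ, hu]
      · simp [pt, pt2, θ, hu]
      · simp [pt, pt2, θ, hu]
    · show pt (Sum.elim (Sum.elim cs ![x]) y) (Sum.inr (θ (Sum.inr j))) = _
      simp [pt, pt2, θ]
  have hbridge : ∀ (cs : Fin r → M) (x : M) (y : Fin m → M),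
      MvPolynomial.aeval (pt (Sum.elim (Sum.elim cs ![x]) y)) P' = MvPolynomial.aeval (pt2 cs x y) P := by
    intro cs x y
    rw [MvPolynomial.aeval_rename, hpt cs x y]
  -- the meaning of `φd` in the `Fin N` variables
  have hφdN : ∀ (cs : Fin r → M) (x : M),
      (φd.relabel ⇑ε).Realize ((Sum.elim (Sum.elim γ cs) ![x]) ∘ ⇑ε.symm) ↔
        φd.Realize (Sum.elim (Sum.elim γ cs) ![x]) := by
    intro cs x
    rw [Formula.realize_relabel]
    have hc : ((Sum.elim (Sum.elim γ cs) ![x]) ∘ ⇑ε.symm) ∘ ⇑ε = Sum.elim (Sum.elim γ cs) ![x] := by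
      funext v; simp
    rw [hc]
  have hP' : ∀ (cs : Fin r → M) (x : M), φd.Realize (Sum.elim (Sum.elim γ cs) ![x]) ↔
      ∃ y : Fin m → M, (∀ j, |y j| < 1) ∧
        MvPolynomial.aeval (pt (Sum.elim (Sum.elim cs ![x]) y)) P' = 0 := by
    intro cs x
    rw [← hφdN, hP M]
    refine exists_congr fun y => and_congr Iff.rfl ?_
    rw [hbridge]
  -- witnesses in `M`
  have hex : ∃ y : Fin m → M, (∀ j, |y j| < 1) ∧
      MvPolynomial.aeval (pt (Sum.elim (Sum.elim C ![d]) y)) P' = 0 :=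
    (hP' C d).1 ((hφd ![d]).2 rfl)
  -- pull the witnesses into `K`, an elementary substructure
  let TK : Language.orderedERing.ElementarySubstructure M :=
    ⟨definableClosureSubstructure Language.orderedERing K,
      isElementary_definableClosureSubstructure_of_orderedField φe hO K⟩
  have hTK : (TK : Set M) = K := by
    show definableClosure Language.orderedERing K = K
    exact hKcl
  obtain ⟨χ, hχ⟩ := exists_eFormula_graph P'
  -- `Ψ(γ, C, x; y) := ⋀ |y_j| < 1 ∧ χ((γ, (C, x), y), 0)`
  let V := (Fin n₀ ⊕ (Fin r ⊕ Fin 1)) ⊕ Fin m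
  let τ : (Fin n₀ ⊕ ((Fin r ⊕ Fin 1) ⊕ Fin m)) ⊕ Fin 1 → Language.orderedERing.Term V :=
    Sum.elim (Sum.elim (fun i => Term.var (Sum.inl (Sum.inl i)))
      (Sum.elim (fun c => Term.var (Sum.inl (Sum.inr c))) (fun j => Term.var (Sum.inr j))))
      (fun _ => φe.onTerm 0)
  let Bd : Language.orderedRing.Formula V := Formula.iInf fun j : Fin m =>
    ((Term.var (Sum.inr j) : Language.orderedRing.Term V).relabel Sum.inl).lt
        ((1 : Language.orderedRing.Term V).relabel Sum.inl) ⊓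
      ((-(Term.var (Sum.inr j)) : Language.orderedRing.Term V).relabel Sum.inl).lt
        ((1 : Language.orderedRing.Term V).relabel Sum.inl)
  let Ψ : Language.orderedERing.Formula V :=
    φe.onFormula Bd ⊓ (BoundedFormula.subst χ τ : Language.orderedERing.Formula V)
  have hΨ : ∀ (x : M) (y : Fin m → M),
      Ψ.Realize (Sum.elim (Sum.elim γ (Sum.elim C ![x])) y) ↔
        ((∀ j, |y j| < 1) ∧ MvPolynomial.aeval (pt (Sum.elim (Sum.elim C ![x]) y)) P' = 0) := by
    intro x y
    have hτ : (fun v => (τ v).realize (Sum.elim (Sum.elim γ (Sum.elim C ![x])) y)) =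
        Sum.elim (Sum.elim γ (Sum.elim (Sum.elim C ![x]) y)) ![(0 : M)] := by
      funext v
      rcases v with (i | (c | j)) | t
      · rfl
      · rcases c with c | c <;> rfl
      · rfl
      · have ht : t = 0 := Subsingleton.elim t 0
        subst ht
        simp [τ, LHom.realize_onTerm]
    have hχ' : Formula.Realize (BoundedFormula.subst χ τ : Language.orderedERing.Formula V)
        (Sum.elim (Sum.elim γ (Sum.elim C ![x])) y) ↔
        MvPolynomial.aeval (pt (Sum.elim (Sum.elim C ![x]) y)) P' = 0 := by
      show BoundedFormula.Realize (BoundedFormula.subst χ τ) _ default ↔ _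
      rw [BoundedFormula.realize_subst, hτ]
      have h := hχ M (Sum.elim γ (Sum.elim (Sum.elim C ![x]) y)) 0
      rw [Formula.Realize] at h
      rw [h]
      exact ⟨fun h' => h'.symm, fun h' => h'.symm⟩
    have hBd : (φe.onFormula Bd).Realize (Sum.elim (Sum.elim γ (Sum.elim C ![x])) y) ↔
        ∀ j, |y j| < 1 := by
      simp only [LHom.realize_onFormula, Bd, Formula.realize_iInf, Formula.realize_inf,
        realize_termLT, Language.orderedRing.realize_neg, Language.orderedRing.realize_one,
        Term.realize_var, Sum.elim_inr]
      refine forall_congr' fun j => ?_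
      rw [abs_lt]
      constructor
      · rintro ⟨h1, h2⟩; exact ⟨by linarith, h1⟩
      · rintro ⟨h1, h2⟩; exact ⟨h2, by linarith⟩
    have hsplit : Ψ.Realize (Sum.elim (Sum.elim γ (Sum.elim C ![x])) y) ↔
        (φe.onFormula Bd).Realize (Sum.elim (Sum.elim γ (Sum.elim C ![x])) y) ∧
          Formula.Realize (BoundedFormula.subst χ τ : Language.orderedERing.Formula V)
            (Sum.elim (Sum.elim γ (Sum.elim C ![x])) y) :=
      Formula.realize_inf
    rw [hsplit, hBd, hχ']
  -- transfer
  have hexK : ∃ y : Fin m → M, (∀ j, y j ∈ K) ∧ Ψ.Realize (Sum.elim (Sum.elim γ (Sum.elim C ![d])) y) := by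
    obtain ⟨y, hy, hy0⟩ := hex
    have hparK : ∀ v : Fin n₀ ⊕ (Fin r ⊕ Fin 1), Sum.elim γ (Sum.elim C ![d]) v ∈ (TK : Set M) := by
      intro v
      rw [hTK]
      rcases v with i | c | t
      · exact hkK (hγk i)
      · exact hCK c
      · have ht : t = 0 := Subsingleton.elim t 0
        subst ht
        exact hdK
    let parS : Fin n₀ ⊕ (Fin r ⊕ Fin 1) → TK := fun v => ⟨_, hparK v⟩
    have hpar : ((TK.subtype : TK → M) ∘ parS) = Sum.elim γ (Sum.elim C ![d]) := by
      funext v; rfl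
    have h1 : (Formula.iExs (Fin m) Ψ).Realize ((TK.subtype : TK → M) ∘ parS) := by
      rw [hpar, Formula.realize_iExs]
      exact ⟨y, (hΨ d y).2 ⟨hy, hy0⟩⟩
    rw [TK.subtype.map_formula, Formula.realize_iExs] at h1
    obtain ⟨yK, hyK⟩ := h1
    have h2 : Ψ.Realize ((TK.subtype : TK → M) ∘ Sum.elim parS yK) := (TK.subtype.map_formula Ψ _).2 hyK
    rw [Sum.comp_elim, hpar] at h2
    refine ⟨fun j => (yK j : M), fun j => ?_, h2⟩
    rw [← hTK]
    exact (yK j).2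
  obtain ⟨β, hβK, hβΨ⟩ := hexK
  rw [hΨ] at hβΨ
  refine ⟨n₀, m, γ, P', β, hγk, fun j => ⟨hβK j, hβΨ.1 j⟩, hβΨ.2, fun x y hy h0 => ?_⟩
  exact (hφd ![x]).1 ((hP' C x).2 ⟨y, hy, h0⟩)

end SmoothData

/-! ### Pulling witnesses into elementary substructures -/

section Pull

open SmoothFunctions

/-- Witnesses of an `L_e`-formula with parameters in an elementary substructure `T` can be taken
in `T`. [folklore] -/
theorem exists_mem_of_realize (T : Language.orderedERing.ElementarySubstructure M)
    {α' γ' : Type} [Finite γ'] (ψ : Language.orderedERing.Formula (α' ⊕ γ')) (par : α' → M)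
    (hpar : ∀ a, par a ∈ T) (hex : ∃ w : γ' → M, ψ.Realize (Sum.elim par w)) :
    ∃ w : γ' → M, (∀ g, w g ∈ T) ∧ ψ.Realize (Sum.elim par w) := by
  let parS : α' → T := fun a => ⟨par a, hpar a⟩
  have hparS : ((T.subtype : T → M) ∘ parS) = par := by funext a; rfl
  have h1 : (Formula.iExs γ' ψ).Realize ((T.subtype : T → M) ∘ parS) := by
    rw [hparS, Formula.realize_iExs]
    exact hex
  rw [T.subtype.map_formula, Formula.realize_iExs] at h1
  obtain ⟨w, hw⟩ := h1
  have h2 : ψ.Realize ((T.subtype : T → M) ∘ Sum.elim parS w) := (T.subtype.map_formula ψ _).2 hw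
  rw [Sum.comp_elim, hparS] at h2
  exact ⟨fun g => (w g : M), fun g => (w g).2, h2⟩

variable {α β κ : Type} [Fintype α] [Fintype β] [Fintype κ]

/-- **Minimizers in an elementary substructure**: the minimum of `|P(z, e(z), ẽ(z))|`,
`z = (u, p)`, over a box `[lo, hi]` with `u, lo, hi` in an elementary substructure `T` of
`M | L_e` is attained at a point of `T` (den Besten, p. 87, applied inside `K ≼ M`).
[cite: DenBesten2016, Theorem 7.1.22 (p. 87)] -/
theorem exists_isMinOn_box_mem (P : MvPolynomial ((α ⊕ (β ⊕ κ)) ⊕ (α ⊕ (β ⊕ κ))) ℤ)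
    (T : Language.orderedERing.ElementarySubstructure M) (u : α → M) (hu : ∀ i, u i ∈ T)
    (lo hi : β ⊕ κ → M) (hlo : ∀ i, lo i ∈ T) (hhi : ∀ i, hi i ∈ T) (hle : ∀ i, lo i ≤ hi i) :
    ∃ p₀ : β ⊕ κ → M, (∀ i, p₀ i ∈ T) ∧ (∀ i, lo i ≤ p₀ i ∧ p₀ i ≤ hi i) ∧
      ∀ p : β ⊕ κ → M, (∀ i, lo i ≤ p i ∧ p i ≤ hi i) →
        |MvPolynomial.aeval
            (Sum.elim (Sum.elim u p₀) (Sum.elim (fun i => EFun.e (u i))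
              (Sum.elim (fun i => EFun.e (p₀ (Sum.inl i)))
                (fun j => if p₀ (Sum.inr j) ^ 2 = 1 then 1
                  else EFun.e (p₀ (Sum.inr j) / (1 - p₀ (Sum.inr j) ^ 2)))))) P| ≤
        |MvPolynomial.aeval
            (Sum.elim (Sum.elim u p) (Sum.elim (fun i => EFun.e (u i))
              (Sum.elim (fun i => EFun.e (p (Sum.inl i)))
                (fun j => if p (Sum.inr j) ^ 2 = 1 then 1
                  else EFun.e (p (Sum.inr j) / (1 - p (Sum.inr j) ^ 2)))))) P| := by
  obtain ⟨ψ, hψ⟩ := exists_eFormula_isMinOn_box P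
  obtain ⟨p₀, hp₀, hmin⟩ := exists_isMinOn_box P M u lo hi hle
  have hpar : ∀ a, Sum.elim u (Sum.elim lo hi) a ∈ T := by
    rintro (i | i | i)
    · exact hu i
    · exact hlo i
    · exact hhi i
  obtain ⟨w, hwT, hw⟩ := exists_mem_of_realize T ψ (Sum.elim u (Sum.elim lo hi)) hpar
    ⟨p₀, (hψ M u lo hi p₀).2 ⟨hp₀, hmin⟩⟩
  exact ⟨w, hwT, (hψ M u lo hi w).1 hw⟩

/-- **Taylor data in an elementary substructure**: for `u, ω` in an elementary substructure `T`
of `M | L_e`, the radius, the coefficients and the bound of `SmoothFunctions.exists_taylor` can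
be taken in `T` (den Besten, p. 88: "We can calculate these bounds in `k`, and these are certain
to also hold in `K`, as `k ≼ K`"). [cite: DenBesten2016, Theorem 7.1.22 (p. 88)] -/
theorem exists_taylor_mem (P : MvPolynomial ((α ⊕ (β ⊕ κ)) ⊕ (α ⊕ (β ⊕ κ))) ℤ) (deg : ℕ)
    (T : Language.orderedERing.ElementarySubstructure M) (u : α → M) (hu : ∀ i, u i ∈ T)
    (ω : β ⊕ κ → M) (hω : ∀ i, ω i ∈ T) :
    ∃ (r₀ : M) (c : (Σ k : Fin (deg + 1), (Fin k → β ⊕ κ)) → M) (B : M),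
      r₀ ∈ T ∧ (∀ ki, c ki ∈ T) ∧ B ∈ T ∧ 0 < r₀ ∧ 0 ≤ B ∧
      ∀ t : M, 0 < t → t < r₀ → ∀ p : β ⊕ κ → M, (∀ i, |p i - ω i| < t) →
        |MvPolynomial.aeval
            (Sum.elim (Sum.elim u p) (Sum.elim (fun i => EFun.e (u i))
              (Sum.elim (fun i => EFun.e (p (Sum.inl i)))
                (fun j => if p (Sum.inr j) ^ 2 = 1 then 1
                  else EFun.e (p (Sum.inr j) / (1 - p (Sum.inr j) ^ 2)))))) P -
          ∑ ki, c ki * ∏ l, (p (ki.2 l) - ω (ki.2 l))| ≤ B * t ^ (deg + 1) := by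
  obtain ⟨ψ, hψ⟩ := exists_eFormula_taylor P deg
  obtain ⟨r₀, c, B, hr₀, hB, h⟩ := exists_taylor P deg M u ω
  have hpar : ∀ a, Sum.elim u ω a ∈ T := by
    rintro (i | i)
    · exact hu i
    · exact hω i
  obtain ⟨w, hwT, hw⟩ := exists_mem_of_realize T ψ (Sum.elim u ω) hpar
    ⟨Sum.elim ![r₀, B] c, (hψ M u ω ![r₀, B] c).2 ⟨⟨hr₀, hB⟩, h⟩⟩
  have hw' : w = Sum.elim (w ∘ Sum.inl) (w ∘ Sum.inr) := by
    funext x; rcases x with x | x <;> rfl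
  rw [hw', hψ M] at hw
  obtain ⟨⟨hr, hB'⟩, h'⟩ := hw
  exact ⟨w (Sum.inl 0), w ∘ Sum.inr, w (Sum.inl 1), hwT _, fun ki => hwT _, hwT _, hr, hB', h'⟩

end Pull

/-! ### The endgame: Taylor approximation, the two boxes, and the transfer to `k*` -/

section Endgame

open AbsoluteInequality SaturationStep SmoothFunctions

/-- Transfer of solvability to a real closed intermediate field, for formulas indexed by finite
types. [cite: DenBesten2016, Theorem 7.1.22 (p. 88)] -/
theorem exists_realize_of_isRealClosed' {F : Type} [Field F] [Algebra F M]
    (S : IntermediateField F M) [IsRealClosed S] {α' γ' : Type} [Fintype α'] [Fintype γ']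
    (ψ : Language.orderedRing.Formula (α' ⊕ γ')) (par : α' → S)
    (hex : ∃ w : γ' → M, ψ.Realize (Sum.elim (fun i => (par i : M)) w)) :
    ∃ w : γ' → S, ψ.Realize (Sum.elim (fun i => (par i : M)) (fun j => (w j : M))) := by
  classical
  let eα := Fintype.equivFin α'
  let eγ := Fintype.equivFin γ'
  let ψN : Language.orderedRing.Formula (Fin (Fintype.card α') ⊕ Fin (Fintype.card γ')) :=
    ψ.relabel (Sum.map ⇑eα ⇑eγ)
  have hψN : ∀ (pa : Fin (Fintype.card α') → M) (w : Fin (Fintype.card γ') → M),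
      ψN.Realize (Sum.elim pa w) ↔ ψ.Realize (Sum.elim (pa ∘ ⇑eα) (w ∘ ⇑eγ)) := by
    intro pa w
    rw [Formula.realize_relabel, Sum.elim_comp_map]
  obtain ⟨w, hw⟩ := hex
  have hexN : ∃ w' : Fin (Fintype.card γ') → M,
      ψN.Realize (Sum.elim (fun i => ((par ∘ ⇑eα.symm) i : M)) w') := by
    refine ⟨w ∘ ⇑eγ.symm, ?_⟩
    rw [hψN]
    have h1 : ((fun i => ((par ∘ ⇑eα.symm) i : M)) ∘ ⇑eα) = fun i => (par i : M) := by
      funext i; simp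
    have h2 : ((w ∘ ⇑eγ.symm) ∘ ⇑eγ) = w := by funext j; simp
    rw [h1, h2]
    exact hw
  obtain ⟨w', hw'⟩ := exists_realize_of_isRealClosed S ψN (par ∘ ⇑eα.symm) hexN
  refine ⟨w' ∘ ⇑eγ, ?_⟩
  rw [hψN] at hw'
  have h1 : ((fun i => ((par ∘ ⇑eα.symm) i : M)) ∘ ⇑eα) = fun i => (par i : M) := by
    funext i; simp
  rw [h1] at hw'
  exact hw'

/-- The generators `k ∪ C̄` lie in `k* = k(C̄)^{alg} ∩ M`. [folklore] -/
theorem mem_kstar_of_mem {k : Set M} {r : ℕ} {C : Fin r → M} {z : M} (hz : z ∈ k ∪ Set.range C) :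
    z ∈ algebraicClosure (Subfield.closure (k ∪ Set.range C)) M :=
  (algebraicClosure (Subfield.closure (k ∪ Set.range C)) M).algebraMap_mem
    ⟨z, Subfield.subset_closure hz⟩

set_option maxHeartbeats 800000 in
/-- **The transfer of (45)–(47) to `k*`** (den Besten 2016, pp. 88–89: "we can express the
conjunction of (42), (43) and (44) as `ψ(d, β₁, …, β_m)`, where `ψ` … is an `L`-formula with
parameters in `k*` … there must be elements `α, β'₁, …, β'_m ∈ k*` such that
`ψ(α, β'₁, …, β'_m)` holds … `|F(c₁, …, c_r, α, β'₁, …, β'_m)| < |c₁|^{N'}`").  Here `G` is the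
function, `Σ c_{k,j} Π (p_{jₗ} - ω_{jₗ})` its Taylor polynomial at `ω` with the bound
`|G(p) - ρ(p)| ≤ B t^{λ+1}` for `‖p - ω‖ < t < r₀`, `η` plays the role of `c₁^{N'}`, and the
excluded interval is `(d/2, 2d)`; the witness `(c̄, d, β; t₀)` in `M` is transferred to the real
closed subfield `k* ⊇ k(c̄)` by model completeness of `RCF`.
[cite: DenBesten2016, Theorem 7.1.22 (pp. 88–89)] -/
theorem exists_mem_algebraicClosure_near (k : Set M) {r m lam : ℕ} (C : Fin r → M)
    (G : ((Fin r ⊕ Fin 1) ⊕ Fin m → M) → M)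
    (c : (Σ q : Fin (lam + 1), (Fin q → (Fin r ⊕ Fin 1) ⊕ Fin m)) → M)
    (ω : (Fin r ⊕ Fin 1) ⊕ Fin m → M) (d η θm r₀ B t₀ : M) (β : Fin m → M)
    (hc : ∀ ki, c ki ∈ algebraicClosure (Subfield.closure (k ∪ Set.range C)) M)
    (hω : ∀ c', ω c' ∈ algebraicClosure (Subfield.closure (k ∪ Set.range C)) M)
    (hη : η ∈ algebraicClosure (Subfield.closure (k ∪ Set.range C)) M)
    (hθm : θm ∈ algebraicClosure (Subfield.closure (k ∪ Set.range C)) M)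
    (hr₀ : r₀ ∈ algebraicClosure (Subfield.closure (k ∪ Set.range C)) M)
    (hB : B ∈ algebraicClosure (Subfield.closure (k ∪ Set.range C)) M)
    (htaylor : ∀ t : M, 0 < t → t < r₀ → ∀ p : (Fin r ⊕ Fin 1) ⊕ Fin m → M,
      (∀ i, |p i - ω i| < t) →
        |G p - ∑ ki, c ki * ∏ l, (p (ki.2 l) - ω (ki.2 l))| ≤ B * t ^ (lam + 1))
    (hnear : ∀ (x : M) (y : Fin m → M), 0 ≤ x → x ≤ 1 → (∀ j, |y j| ≤ 1 - θm) →
      |G (Sum.elim (Sum.elim C ![x]) y)| < η → d / 2 < x ∧ x < 2 * d)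
    (hd0 : 0 ≤ d) (hd1 : d ≤ 1) (hβ : ∀ j, |β j| ≤ 1 - θm)
    (hρ : 2 * |∑ ki, c ki * ∏ l,
      ((Sum.elim (Sum.elim C ![d]) β : (Fin r ⊕ Fin 1) ⊕ Fin m → M) (ki.2 l) - ω (ki.2 l))| < η)
    (hdist : ∀ c', |(Sum.elim (Sum.elim C ![d]) β : (Fin r ⊕ Fin 1) ⊕ Fin m → M) c' - ω c'| < t₀)
    (ht₀ : 0 < t₀) (ht₀r₀ : t₀ < r₀) (hkey : 2 * B * t₀ ^ (lam + 1) < η) :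
    ∃ α ∈ algebraicClosure (Subfield.closure (k ∪ Set.range C)) M, d / 2 < α ∧ α < 2 * d := by
  classical
  -- the real closed field `k*`
  let kstar : IntermediateField (Subfield.closure (k ∪ Set.range C)) M :=
    algebraicClosure (Subfield.closure (k ∪ Set.range C)) M
  haveI : IsRealClosed kstar := isRealClosed_algebraicClosure _
  have hCks : ∀ i, C i ∈ kstar := fun i => mem_kstar_of_mem (Or.inr ⟨i, rfl⟩)
  -- parameters `(c, ω, C̄, (η, θ, r₀, B))` in `k*`, witness `((C̄, d, β), t₀)` in `M`
  let parM : (((Σ q : Fin (lam + 1), (Fin q → (Fin r ⊕ Fin 1) ⊕ Fin m)) ⊕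
      ((Fin r ⊕ Fin 1) ⊕ Fin m)) ⊕ Fin r) ⊕ Fin 4 → M :=
    Sum.elim (Sum.elim (Sum.elim c ω) C) ![η, θm, r₀, B]
  have hparM : ∀ i, parM i ∈ kstar := by
    rintro (((ki | c') | i) | s)
    · exact hc ki
    · exact hω c'
    · exact hCks i
    · fin_cases s
      · exact hη
      · exact hθm
      · exact hr₀
      · exact hB
  let par : (((Σ q : Fin (lam + 1), (Fin q → (Fin r ⊕ Fin 1) ⊕ Fin m)) ⊕
      ((Fin r ⊕ Fin 1) ⊕ Fin m)) ⊕ Fin r) ⊕ Fin 4 → kstar := fun i => ⟨parM i, hparM i⟩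
  let w₀ : ((Fin r ⊕ Fin 1) ⊕ Fin m) ⊕ Fin 1 → M := Sum.elim (Sum.elim (Sum.elim C ![d]) β) ![t₀]
  -- the Taylor polynomial in the variables `(c, p, ω)` and its term
  let Q : MvPolynomial ((Σ q : Fin (lam + 1), (Fin q → (Fin r ⊕ Fin 1) ⊕ Fin m)) ⊕
      (((Fin r ⊕ Fin 1) ⊕ Fin m) ⊕ ((Fin r ⊕ Fin 1) ⊕ Fin m))) ℤ :=
    ∑ ki : (Σ q : Fin (lam + 1), (Fin q → (Fin r ⊕ Fin 1) ⊕ Fin m)), MvPolynomial.X (Sum.inl ki) *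
      ∏ l, (MvPolynomial.X (Sum.inr (Sum.inl (ki.2 l))) - MvPolynomial.X (Sum.inr (Sum.inr (ki.2 l))))
  obtain ⟨tQ, htQ⟩ := exists_term_realize_eq_aeval Q
  obtain ⟨tpow, htpow⟩ := SmoothFunctions.exists_term_pow
    (Sum.inr (Sum.inr 0) : ((((Σ q : Fin (lam + 1), (Fin q → (Fin r ⊕ Fin 1) ⊕ Fin m)) ⊕
      ((Fin r ⊕ Fin 1) ⊕ Fin m)) ⊕ Fin r) ⊕ Fin 4) ⊕ (((Fin r ⊕ Fin 1) ⊕ Fin m) ⊕ Fin 1)) (lam + 1)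
  let ρT : Language.orderedRing.Term (((((Σ q : Fin (lam + 1), (Fin q → (Fin r ⊕ Fin 1) ⊕ Fin m)) ⊕
      ((Fin r ⊕ Fin 1) ⊕ Fin m)) ⊕ Fin r) ⊕ Fin 4) ⊕ (((Fin r ⊕ Fin 1) ⊕ Fin m) ⊕ Fin 1)) :=
    tQ.relabel (Sum.elim (fun ki => Sum.inl (Sum.inl (Sum.inl (Sum.inl ki))))
      (Sum.elim (fun c' => Sum.inr (Sum.inl c')) (fun c' => Sum.inl (Sum.inl (Sum.inl (Sum.inr c'))))))
  -- the formula `ψ(par; p, t)`: (45) ∧ (46) ∧ (47) with `c̄` pinned and `t` existential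
  let LT' : ∀ {W : Type}, Language.orderedRing.Term W → Language.orderedRing.Term W →
      Language.orderedRing.Formula W := fun t₁ t₂ => (t₁.relabel Sum.inl).lt (t₂.relabel Sum.inl)
  let LE' : ∀ {W : Type}, Language.orderedRing.Term W → Language.orderedRing.Term W →
      Language.orderedRing.Formula W := fun t₁ t₂ => (t₁.relabel Sum.inl).le (t₂.relabel Sum.inl)
  let ψ : Language.orderedRing.Formula (((((Σ q : Fin (lam + 1), (Fin q → (Fin r ⊕ Fin 1) ⊕ Fin m)) ⊕
      ((Fin r ⊕ Fin 1) ⊕ Fin m)) ⊕ Fin r) ⊕ Fin 4) ⊕ (((Fin r ⊕ Fin 1) ⊕ Fin m) ⊕ Fin 1)) :=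
    (Formula.iInf fun i : Fin r =>
      Term.equal (Term.var (Sum.inr (Sum.inl (Sum.inl (Sum.inl i)))))
        (Term.var (Sum.inl (Sum.inl (Sum.inr i))))) ⊓
    ((LT' (ρT + ρT) (Term.var (Sum.inl (Sum.inr 0))) ⊓
      LT' (-(ρT + ρT)) (Term.var (Sum.inl (Sum.inr 0)))) ⊓
    ((LE' 0 (Term.var (Sum.inr (Sum.inl (Sum.inl (Sum.inr 0))))) ⊓
      LE' (Term.var (Sum.inr (Sum.inl (Sum.inl (Sum.inr 0))))) 1) ⊓
    ((Formula.iInf fun j : Fin m =>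
      LE' (Term.var (Sum.inr (Sum.inl (Sum.inr j)))) (1 + -(Term.var (Sum.inl (Sum.inr 1)))) ⊓
        LE' (-(Term.var (Sum.inr (Sum.inl (Sum.inr j))))) (1 + -(Term.var (Sum.inl (Sum.inr 1))))) ⊓
    ((LT' 0 (Term.var (Sum.inr (Sum.inr 0))) ⊓
      LT' (Term.var (Sum.inr (Sum.inr 0))) (Term.var (Sum.inl (Sum.inr 2)))) ⊓
    (LT' (Term.var (Sum.inl (Sum.inr 3)) * tpow + Term.var (Sum.inl (Sum.inr 3)) * tpow)
      (Term.var (Sum.inl (Sum.inr 0))) ⊓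
    (Formula.iInf fun c' : (Fin r ⊕ Fin 1) ⊕ Fin m =>
      LT' (Term.var (Sum.inr (Sum.inl c')) + -(Term.var (Sum.inl (Sum.inl (Sum.inl (Sum.inr c'))))))
          (Term.var (Sum.inr (Sum.inr 0))) ⊓
        LT' (-(Term.var (Sum.inr (Sum.inl c')) + -(Term.var (Sum.inl (Sum.inl (Sum.inl (Sum.inr c')))))))
          (Term.var (Sum.inr (Sum.inr 0)))))))))
  have hψ : ∀ v : ((((Σ q : Fin (lam + 1), (Fin q → (Fin r ⊕ Fin 1) ⊕ Fin m)) ⊕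
      ((Fin r ⊕ Fin 1) ⊕ Fin m)) ⊕ Fin r) ⊕ Fin 4) ⊕ (((Fin r ⊕ Fin 1) ⊕ Fin m) ⊕ Fin 1) → M,
      ψ.Realize v ↔
        (∀ i : Fin r, v (Sum.inr (Sum.inl (Sum.inl (Sum.inl i)))) = v (Sum.inl (Sum.inl (Sum.inr i)))) ∧
        (((∑ ki, v (Sum.inl (Sum.inl (Sum.inl (Sum.inl ki)))) *
              ∏ l, (v (Sum.inr (Sum.inl (ki.2 l))) - v (Sum.inl (Sum.inl (Sum.inl (Sum.inr (ki.2 l))))))) +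
            (∑ ki, v (Sum.inl (Sum.inl (Sum.inl (Sum.inl ki)))) *
              ∏ l, (v (Sum.inr (Sum.inl (ki.2 l))) - v (Sum.inl (Sum.inl (Sum.inl (Sum.inr (ki.2 l))))))) <
            v (Sum.inl (Sum.inr 0))) ∧
          (-((∑ ki, v (Sum.inl (Sum.inl (Sum.inl (Sum.inl ki)))) *
              ∏ l, (v (Sum.inr (Sum.inl (ki.2 l))) - v (Sum.inl (Sum.inl (Sum.inl (Sum.inr (ki.2 l))))))) +
            (∑ ki, v (Sum.inl (Sum.inl (Sum.inl (Sum.inl ki)))) *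
              ∏ l, (v (Sum.inr (Sum.inl (ki.2 l))) - v (Sum.inl (Sum.inl (Sum.inl (Sum.inr (ki.2 l)))))))) <
            v (Sum.inl (Sum.inr 0)))) ∧
        ((0 ≤ v (Sum.inr (Sum.inl (Sum.inl (Sum.inr 0))))) ∧ v (Sum.inr (Sum.inl (Sum.inl (Sum.inr 0)))) ≤ 1) ∧
        (∀ j : Fin m, (v (Sum.inr (Sum.inl (Sum.inr j))) ≤ 1 + -v (Sum.inl (Sum.inr 1))) ∧
          -v (Sum.inr (Sum.inl (Sum.inr j))) ≤ 1 + -v (Sum.inl (Sum.inr 1))) ∧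
        ((0 < v (Sum.inr (Sum.inr 0))) ∧ v (Sum.inr (Sum.inr 0)) < v (Sum.inl (Sum.inr 2))) ∧
        (v (Sum.inl (Sum.inr 3)) * v (Sum.inr (Sum.inr 0)) ^ (lam + 1) +
            v (Sum.inl (Sum.inr 3)) * v (Sum.inr (Sum.inr 0)) ^ (lam + 1) < v (Sum.inl (Sum.inr 0))) ∧
        (∀ c' : (Fin r ⊕ Fin 1) ⊕ Fin m,
          (v (Sum.inr (Sum.inl c')) + -v (Sum.inl (Sum.inl (Sum.inl (Sum.inr c')))) < v (Sum.inr (Sum.inr 0))) ∧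
            -(v (Sum.inr (Sum.inl c')) + -v (Sum.inl (Sum.inl (Sum.inl (Sum.inr c'))))) <
              v (Sum.inr (Sum.inr 0))) := by
    intro v
    have hρT : ρT.realize v = ∑ ki, v (Sum.inl (Sum.inl (Sum.inl (Sum.inl ki)))) *
        ∏ l, (v (Sum.inr (Sum.inl (ki.2 l))) - v (Sum.inl (Sum.inl (Sum.inl (Sum.inr (ki.2 l)))))) := by
      simp only [ρT, Term.realize_relabel, htQ, Q, _root_.map_sum, _root_.map_mul, _root_.map_prod,
        _root_.map_sub, MvPolynomial.aeval_X, Function.comp_apply, Sum.elim_inl, Sum.elim_inr]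
    simp only [ψ, LT', LE', Formula.realize_inf, Formula.realize_iInf, Formula.realize_equal,
      realize_termLT, realize_termLE, Language.orderedRing.realize_add,
      Language.orderedRing.realize_mul, Language.orderedRing.realize_neg,
      Language.orderedRing.realize_one, Language.orderedRing.realize_zero, Term.realize_var, hρT,
      htpow]
  -- the witness in `M`
  have hw₀ : ψ.Realize (Sum.elim parM w₀) := by
    rw [hψ]
    refine ⟨fun i => rfl, ?_, ?_, ?_, ?_, ?_, ?_⟩
    · have h1 := abs_lt.1 (show |∑ ki, c ki * ∏ l,
        ((Sum.elim (Sum.elim C ![d]) β : (Fin r ⊕ Fin 1) ⊕ Fin m → M) (ki.2 l) - ω (ki.2 l))| < η / 2 by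
          linarith [hρ])
      show (∑ ki, c ki * ∏ l, ((Sum.elim (Sum.elim C ![d]) β : (Fin r ⊕ Fin 1) ⊕ Fin m → M) (ki.2 l) -
          ω (ki.2 l))) + (∑ ki, c ki * ∏ l, ((Sum.elim (Sum.elim C ![d]) β : (Fin r ⊕ Fin 1) ⊕ Fin m → M)
          (ki.2 l) - ω (ki.2 l))) < η ∧
        -((∑ ki, c ki * ∏ l, ((Sum.elim (Sum.elim C ![d]) β : (Fin r ⊕ Fin 1) ⊕ Fin m → M) (ki.2 l) -
          ω (ki.2 l))) + (∑ ki, c ki * ∏ l, ((Sum.elim (Sum.elim C ![d]) β : (Fin r ⊕ Fin 1) ⊕ Fin m → M)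
          (ki.2 l) - ω (ki.2 l)))) < η
      constructor <;> linarith [h1.1, h1.2]
    · show 0 ≤ d ∧ d ≤ 1
      exact ⟨hd0, hd1⟩
    · intro j
      have h := abs_le.1 (hβ j)
      show β j ≤ 1 + -θm ∧ -β j ≤ 1 + -θm
      constructor <;> linarith [h.1, h.2]
    · show 0 < t₀ ∧ t₀ < r₀
      exact ⟨ht₀, ht₀r₀⟩
    · show B * t₀ ^ (lam + 1) + B * t₀ ^ (lam + 1) < η
      linarith [hkey]
    · intro c'
      have h := abs_lt.1 (hdist c')
      show (Sum.elim (Sum.elim C ![d]) β : (Fin r ⊕ Fin 1) ⊕ Fin m → M) c' + -ω c' < t₀ ∧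
        -((Sum.elim (Sum.elim C ![d]) β : (Fin r ⊕ Fin 1) ⊕ Fin m → M) c' + -ω c') < t₀
      constructor <;> linarith [h.1, h.2]
  -- the transfer
  obtain ⟨w, hw⟩ := exists_realize_of_isRealClosed' kstar ψ par ⟨w₀, hw₀⟩
  rw [hψ] at hw
  obtain ⟨hpin, hρ', hx', hy', ht', hkey', hdist'⟩ := hw
  let p' : (Fin r ⊕ Fin 1) ⊕ Fin m → M := fun c' => (w (Sum.inl c') : M)
  let t : M := (w (Sum.inr 0) : M)
  have hpin' : ∀ i, p' (Sum.inl (Sum.inl i)) = C i := hpin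
  have hρ'' : (∑ ki, c ki * ∏ l, (p' (ki.2 l) - ω (ki.2 l))) +
        (∑ ki, c ki * ∏ l, (p' (ki.2 l) - ω (ki.2 l))) < η ∧
      -((∑ ki, c ki * ∏ l, (p' (ki.2 l) - ω (ki.2 l))) +
        ∑ ki, c ki * ∏ l, (p' (ki.2 l) - ω (ki.2 l))) < η := hρ'
  have hx'' : 0 ≤ p' (Sum.inl (Sum.inr 0)) ∧ p' (Sum.inl (Sum.inr 0)) ≤ 1 := hx'
  have hy'' : ∀ j, p' (Sum.inr j) ≤ 1 + -θm ∧ -p' (Sum.inr j) ≤ 1 + -θm := hy'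
  have ht'' : 0 < t ∧ t < r₀ := ht'
  have hkey'' : B * t ^ (lam + 1) + B * t ^ (lam + 1) < η := hkey'
  have hdist'' : ∀ c', |p' c' - ω c'| < t := fun c' => by
    have h : p' c' + -ω c' < t ∧ -(p' c' + -ω c') < t := hdist' c'
    rw [abs_lt]
    constructor <;> linarith [h.1, h.2]
  -- `|G(p')| < η`
  have hGp' : |G p'| < η := by
    have h1 := htaylor t ht''.1 ht''.2 p' hdist''
    have h2 : |∑ ki, c ki * ∏ l, (p' (ki.2 l) - ω (ki.2 l))| < η / 2 := by
      rw [abs_lt]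
      constructor <;> linarith [hρ''.1, hρ''.2]
    have h3 : B * t ^ (lam + 1) < η / 2 := by linarith [hkey'']
    calc |G p'| = |(G p' - ∑ ki, c ki * ∏ l, (p' (ki.2 l) - ω (ki.2 l))) +
          ∑ ki, c ki * ∏ l, (p' (ki.2 l) - ω (ki.2 l))| := by rw [sub_add_cancel]
      _ ≤ |G p' - ∑ ki, c ki * ∏ l, (p' (ki.2 l) - ω (ki.2 l))| +
          |∑ ki, c ki * ∏ l, (p' (ki.2 l) - ω (ki.2 l))| := abs_add_le _ _
      _ < η := by linarith [h1, h2, h3]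
  -- the shape of `p'` and the conclusion
  have hshape : p' = Sum.elim (Sum.elim C ![p' (Sum.inl (Sum.inr 0))]) (p' ∘ Sum.inr) := by
    funext c'
    rcases c' with (i | s) | j
    · exact hpin' i
    · have hs : s = 0 := Subsingleton.elim s 0
      subst hs; rfl
    · rfl
  have hyabs : ∀ j, |(p' ∘ Sum.inr) j| ≤ 1 - θm := fun j => by
    have h := hy'' j
    show |p' (Sum.inr j)| ≤ 1 - θm
    rw [abs_le]
    exact ⟨by linarith [h.2], by linarith [h.1]⟩
  obtain ⟨hα1, hα2⟩ := hnear (p' (Sum.inl (Sum.inr 0))) (p' ∘ Sum.inr) hx''.1 hx''.2 hyabs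
    (by rw [← hshape]; exact hGp')
  exact ⟨p' (Sum.inl (Sum.inr 0)), (w (Sum.inl (Sum.inl (Sum.inr 0)))).2, hα1, hα2⟩

variable {r n₀ m : ℕ}

set_option maxHeartbeats 800000 in
/-- **The endgame of the surjectivity step** (den Besten 2016, proof of Theorem 7.1.22,
pp. 87–89: the minimum `γ` of `|F(c̄, ·, ·)|` on `([0,1] ∖ (d/2, 2d)) × A`, the Taylor polynomial
`ρ_λ` of `F` at the `k`-rational point `ω = (0̄, 0, β⁰)` with `t₀^{λ+1} < (2B_λ)⁻¹ |c₁|^{N'}`, and the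
transfer of (45)–(47) to the real closed field `k* ⊇ k(c̄)`, producing `α ∈ k*` with
`d/2 < α < 2d`).  Deviations: the excluded interval is `(d/2, 2d)` (the printed `(d/2, 2d/3)`
does not contain `d`); the box `A` has margin `θ = c₁^{2L}`; (47) is used with an
existentially quantified `t` (no roots needed); the Taylor data come with a radius `r₀ ∈ k`.
[cite: DenBesten2016, Theorem 7.1.22 (pp. 87–89)] -/
theorem endgame (hMC : rexpTheory.IsModelComplete) (K k : Set M)
    (hKcl : definableClosure Language.orderedERing K = K)
    (hkcl : definableClosure Language.orderedERing k = k) (hkK : k ⊆ K)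
    (a : M) (ha : 0 < a) (hainf : ∀ n : ℕ, (n : M) * a < 1)
    (hcoi : ∀ b ∈ K, 0 < b → ∃ q : ℕ, a ^ q < b)
    (hkR : ∀ b ∈ k, ∀ q : ℕ, |b| ^ q * a < 1)
    (hsplit : ∀ b ∈ K, (∀ q : ℕ, |b| ^ q * a < 1) → ∃ b₀ ∈ k, ∃ q : ℕ, |b - b₀| ^ (q + 1) ≤ a)
    (C : Fin r → M) (hCK : ∀ i, C i ∈ K) (hCI : ∀ i, ∃ q : ℕ, |C i| ^ (q + 1) ≤ a)
    (hKgen : K ⊆ definableClosure Language.orderedERing (k ∪ Set.range C))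
    (d : M) (hdK : d ∈ K) (hd : 0 < d) (hdI : ∃ q : ℕ, |d| ^ (q + 1) ≤ a)
    (γ : Fin n₀ → M) (hγk : ∀ i, γ i ∈ k)
    (P : MvPolynomial ((Fin n₀ ⊕ ((Fin r ⊕ Fin 1) ⊕ Fin m)) ⊕
      (Fin n₀ ⊕ ((Fin r ⊕ Fin 1) ⊕ Fin m))) ℤ)
    (β : Fin m → M) (hβ : ∀ j, β j ∈ K ∧ |β j| < 1)
    (hzero : MvPolynomial.aeval (Sum.elim (Sum.elim γ (Sum.elim (Sum.elim C ![d]) β)) (Sum.elim (fun i => EFun.e (γ i)) (Sum.elim (fun i => EFun.e ((Sum.elim (Sum.elim C ![d]) β : (Fin r ⊕ Fin 1) ⊕ Fin m → M) (Sum.inl i))) (fun j => if (Sum.elim (Sum.elim C ![d]) β : (Fin r ⊕ Fin 1) ⊕ Fin m → M) (Sum.inr j) ^ 2 = 1 then 1 else EFun.e ((Sum.elim (Sum.elim C ![d]) β : (Fin r ⊕ Fin 1) ⊕ Fin m → M) (Sum.inr j) / (1 - (Sum.elim (Sum.elim C ![d]) β : (Fin r ⊕ Fin 1) ⊕ Fin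 m → M) (Sum.inr j) ^ 2)))))) P = 0)
    (huniq : ∀ (x : M) (y : Fin m → M), (∀ j, |y j| < 1) →
      MvPolynomial.aeval (Sum.elim (Sum.elim γ (Sum.elim (Sum.elim C ![x]) y)) (Sum.elim (fun i => EFun.e (γ i)) (Sum.elim (fun i => EFun.e ((Sum.elim (Sum.elim C ![x]) y : (Fin r ⊕ Fin 1) ⊕ Fin m → M) (Sum.inl i))) (fun j => if (Sum.elim (Sum.elim C ![x]) y : (Fin r ⊕ Fin 1) ⊕ Fin m → M) (Sum.inr j) ^ 2 = 1 then 1 else EFun.e ((Sum.elim (Sum.elim C ![x]) y : (Fin r ⊕ Fin 1) ⊕ Fin m → M) (Sum.inr j) / (1 - (Sum.elim (Sum.elim C ![x]) y : (Fin r ⊕ Fin 1) ⊕ Fin m → M) (Sum.inr j) ^ 2)))))) P = 0 → x = d) :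
    ∃ α : M, (∃ p : Polynomial M, p ≠ 0 ∧
      (∀ n, p.coeff n ∈ Subring.closure (k ∪ Set.range C)) ∧ p.eval α = 0) ∧
      IsVUnit (α / d) := by
  classical
  set φe : Language.orderedRing →ᴸ Language.orderedERing := LHom.sumInl with hφe
  have ha1 : a < 1 := scale_lt_one hainf
  -- the function
  let pt : ((Fin r ⊕ Fin 1) ⊕ Fin m → M) →
      (Fin n₀ ⊕ ((Fin r ⊕ Fin 1) ⊕ Fin m)) ⊕ (Fin n₀ ⊕ ((Fin r ⊕ Fin 1) ⊕ Fin m)) → M :=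
    fun p => Sum.elim (Sum.elim γ p) (Sum.elim (fun i => EFun.e (γ i))
      (Sum.elim (fun i => EFun.e (p (Sum.inl i)))
        (fun j => if p (Sum.inr j) ^ 2 = 1 then 1 else EFun.e (p (Sum.inr j) / (1 - p (Sum.inr j) ^ 2)))))
  have hzero' : MvPolynomial.aeval (pt (Sum.elim (Sum.elim C ![d]) β)) P = 0 := hzero
  have huniq' : ∀ (x : M) (y : Fin m → M), (∀ j, |y j| < 1) →
      MvPolynomial.aeval (pt (Sum.elim (Sum.elim C ![x]) y)) P = 0 → x = d := huniq
  -- `K` and `k` are subfields; elementary substructures `TK`, `Tk`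
  have hKof : ∀ {z : M}, z ∈ definableClosure Language.orderedERing K → z ∈ K := fun hz => by
    rwa [hKcl] at hz
  have hkof : ∀ {z : M}, z ∈ definableClosure Language.orderedERing k → z ∈ k := fun hz => by
    rwa [hkcl] at hz
  have hK1 : (1 : M) ∈ K := hKof (DclClaim.one_mem_definableClosure φe)
  have hK0 : (0 : M) ∈ K := hKof (definableClosure_mono (Set.empty_subset _) (zero_mem_definableClosure φe))
  have hk0 : (0 : M) ∈ k := hkof (definableClosure_mono (Set.empty_subset _) (zero_mem_definableClosure φe))
  have hKneg : ∀ z ∈ K, -z ∈ K := fun z hz =>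
    hKof (OrderedFieldExpansion.neg_mem_definableClosure φe (subset_definableClosure K hz))
  have hKadd : ∀ z ∈ K, ∀ w ∈ K, z + w ∈ K := fun z hz w hw =>
    hKof (OrderedFieldExpansion.add_mem_definableClosure φe (subset_definableClosure K hz)
      (subset_definableClosure K hw))
  have hKsub : ∀ z ∈ K, ∀ w ∈ K, z - w ∈ K := fun z hz w hw =>
    hKof (OrderedFieldExpansion.sub_mem_definableClosure φe (subset_definableClosure K hz)
      (subset_definableClosure K hw))
  have hKmul : ∀ z ∈ K, ∀ w ∈ K, z * w ∈ K := fun z hz w hw =>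
    hKof (DclClaim.mul_mem_definableClosure φe (subset_definableClosure K hz)
      (subset_definableClosure K hw))
  have hKinv : ∀ z ∈ K, z⁻¹ ∈ K := fun z hz =>
    hKof (OrderedFieldExpansion.inv_mem_definableClosure φe (subset_definableClosure K hz))
  have hKabs : ∀ z ∈ K, |z| ∈ K := fun z hz => by
    rcases abs_choice z with h | h
    · rw [h]; exact hz
    · rw [h]; exact hKneg z hz
  have hKpow : ∀ z ∈ K, ∀ n : ℕ, z ^ n ∈ K := fun z hz n => by
    induction n with
    | zero => simpa using hK1
    | succ n ih => rw [pow_succ]; exact hKmul _ ih _ hz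
  have hKnat : ∀ n : ℕ, (n : M) ∈ K := fun n => by
    induction n with
    | zero => simpa using hK0
    | succ n ih => rw [Nat.cast_succ]; exact hKadd _ ih _ hK1
  have hkinv : ∀ z ∈ k, z⁻¹ ∈ k := fun z hz =>
    hkof (OrderedFieldExpansion.inv_mem_definableClosure φe (subset_definableClosure k hz))
  -- some generator is non-zero
  have hdk : d ∉ k := fun hdk =>
    lt_irrefl d (lt_of_inI_of_mem ha hainf hkR hkinv hdk hd hdI)
  have hC0 : ∃ i, C i ≠ 0 := by
    by_contra hall
    push Not at hall
    apply hdk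
    refine hkof (definableClosure_subset_of_subset ?_ (hKgen hdK))
    rintro z (hz | ⟨i, rfl⟩)
    · exact subset_definableClosure _ hz
    · rw [hall i]
      exact definableClosure_mono (Set.empty_subset _) (zero_mem_definableClosure φe)
  obtain ⟨i₁, hi₁⟩ := hC0
  have hc₁lt : |C i₁| < 1 := by
    obtain ⟨q, hq⟩ := hCI i₁
    by_contra h
    push Not at h
    have : (1 : M) ≤ |C i₁| ^ (q + 1) := one_le_pow₀ h
    linarith
  have hc₁pos : 0 < |C i₁| := abs_pos.2 hi₁
  -- elementary substructures with carriers `K` and `k`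
  have hO : Language.orderedERing.IsOMinimal M :=
    isOMinimal_orderedERing_of_rexp_isModelComplete hMC M
  let TK : Language.orderedERing.ElementarySubstructure M :=
    ⟨definableClosureSubstructure Language.orderedERing K,
      isElementary_definableClosureSubstructure_of_orderedField φe hO K⟩
  have hTK : ∀ {z : M}, z ∈ TK ↔ z ∈ K := fun {z} => by
    show z ∈ definableClosure Language.orderedERing K ↔ z ∈ K
    rw [hKcl]
  let Tk : Language.orderedERing.ElementarySubstructure M :=
    ⟨definableClosureSubstructure Language.orderedERing k,
      isElementary_definableClosureSubstructure_of_orderedField φe hO k⟩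
  have hTk : ∀ {z : M}, z ∈ Tk ↔ z ∈ k := fun {z} => by
    show z ∈ definableClosure Language.orderedERing k ↔ z ∈ k
    rw [hkcl]
  -- values of `F` at points of `K` lie in `K`
  obtain ⟨χ, hχ⟩ := exists_eFormula_graph P
  have hFK : ∀ p : (Fin r ⊕ Fin 1) ⊕ Fin m → M, (∀ c, p c ∈ K) →
      MvPolynomial.aeval (pt p) P ∈ K := by
    intro p hp
    refine hKof (definableClosure_mono ?_
      (mem_definableClosure_of_forall_realize_iff (q := Sum.elim γ p) χ fun v => ?_))
    · rintro _ ⟨c, rfl⟩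
      rcases c with i | c
      · exact hkK (hγk i)
      · exact hp c
    · have hv : v = ![v 0] := by
        funext j
        have hj : j = 0 := Subsingleton.elim j 0
        subst hj; rfl
      rw [hv]
      exact hχ M (Sum.elim γ p) (v 0)
  -- Step 5: `β⁰ ∈ k`
  have hβR : ∀ j, ∀ q : ℕ, |β j| ^ q * a < 1 := fun j q => by
    have h1 : |β j| ^ q ≤ 1 := pow_le_one₀ (abs_nonneg _) (hβ j).2.le
    calc |β j| ^ q * a ≤ 1 * a := by gcongr
      _ = a := one_mul a
      _ < 1 := ha1
  have hβ₀ex : ∀ j, ∃ b₀ ∈ k, ∃ q : ℕ, |β j - b₀| ^ (q + 1) ≤ a :=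
    fun j => hsplit (β j) (hβ j).1 (hβR j)
  choose β₀ hβ₀k hβ₀I using hβ₀ex
  -- Step 6: the margin `θm = c₁^{2L}`
  have hmarg : ∀ j, ∃ l : ℕ, 0 < l ∧ |C i₁| ^ l < 1 - |β j| := fun j =>
    exists_pow_lt_of_inI hainf hcoi (hKsub 1 hK1 _ (hKabs _ (hβ j).1)) (by linarith [(hβ j).2]) (hCI i₁)
  choose l hl0 hl using hmarg
  set L : ℕ := ∑ j, l j + 1 with hL
  have hlL : ∀ j, l j ≤ 2 * L := fun j => by
    have : l j ≤ ∑ j, l j := Finset.single_le_sum (fun j _ => Nat.zero_le (l j)) (Finset.mem_univ j)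
    omega
  set θm : M := C i₁ ^ (2 * L) with hθm
  have hθmabs : θm = |C i₁| ^ (2 * L) := by
    rw [hθm, pow_mul, pow_mul, ← sq_abs]
  have hθmpos : 0 < θm := by rw [hθmabs]; exact pow_pos hc₁pos _
  have hθmlt : θm < 1 := by
    rw [hθmabs]
    exact pow_lt_one₀ (abs_nonneg _) hc₁lt (by omega)
  have hθmβ : ∀ j, θm < 1 - |β j| := fun j => by
    rw [hθmabs]
    exact (pow_le_pow_of_le_one (abs_nonneg _) hc₁lt.le (hlL j)).trans_lt (hl j)
  have hθmK : θm ∈ K := hKpow _ (hCK i₁) _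
  -- Step 7: the two boxes `[0, d/2] × A` and `[2d, 1] × A`, `A = [-(1 - θm), 1 - θm]ᵐ`, `c̄` pinned
  have hd2 : 2 * d < 1 := by
    have h := natCast_mul_abs_lt_one_of_pow_le hainf (Classical.choose_spec hdI) 2
    rw [abs_of_pos hd] at h
    exact_mod_cast h
  have hdhalfK : d / 2 ∈ K := by
    rw [div_eq_mul_inv]; exact hKmul _ hdK _ (hKinv _ (hKnat 2))
  have h2dK : 2 * d ∈ K := hKmul _ (hKnat 2) _ hdK
  have h1θK : 1 - θm ∈ K := hKsub _ hK1 _ hθmK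
  have hnθK : -(1 - θm) ∈ K := hKneg _ h1θK
  have hγK : ∀ i, γ i ∈ TK := fun i => hTK.2 (hkK (hγk i))
  -- box 1
  let lo₁ : (Fin r ⊕ Fin 1) ⊕ Fin m → M := Sum.elim (Sum.elim C ![0]) fun _ => -(1 - θm)
  let hi₁ : (Fin r ⊕ Fin 1) ⊕ Fin m → M := Sum.elim (Sum.elim C ![d / 2]) fun _ => 1 - θm
  let lo₂ : (Fin r ⊕ Fin 1) ⊕ Fin m → M := Sum.elim (Sum.elim C ![2 * d]) fun _ => -(1 - θm)
  let hi₂ : (Fin r ⊕ Fin 1) ⊕ Fin m → M := Sum.elim (Sum.elim C ![1]) fun _ => 1 - θm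
  have hle₁ : ∀ c, lo₁ c ≤ hi₁ c := by
    rintro ((i | t) | j)
    · exact le_rfl
    · have ht : t = 0 := Subsingleton.elim t 0
      subst ht
      show (0 : M) ≤ d / 2
      linarith
    · show -(1 - θm) ≤ 1 - θm
      linarith
  have hle₂ : ∀ c, lo₂ c ≤ hi₂ c := by
    rintro ((i | t) | j)
    · exact le_rfl
    · have ht : t = 0 := Subsingleton.elim t 0
      subst ht
      show 2 * d ≤ (1 : M)
      linarith
    · show -(1 - θm) ≤ 1 - θm
      linarith
  have hlo₁K : ∀ c, lo₁ c ∈ TK := by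
    rintro ((i | t) | j)
    · exact hTK.2 (hCK i)
    · have ht : t = 0 := Subsingleton.elim t 0
      subst ht; exact hTK.2 hK0
    · exact hTK.2 hnθK
  have hhi₁K : ∀ c, hi₁ c ∈ TK := by
    rintro ((i | t) | j)
    · exact hTK.2 (hCK i)
    · have ht : t = 0 := Subsingleton.elim t 0
      subst ht; exact hTK.2 hdhalfK
    · exact hTK.2 h1θK
  have hlo₂K : ∀ c, lo₂ c ∈ TK := by
    rintro ((i | t) | j)
    · exact hTK.2 (hCK i)
    · have ht : t = 0 := Subsingleton.elim t 0
      subst ht; exact hTK.2 h2dK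
    · exact hTK.2 hnθK
  have hhi₂K : ∀ c, hi₂ c ∈ TK := by
    rintro ((i | t) | j)
    · exact hTK.2 (hCK i)
    · have ht : t = 0 := Subsingleton.elim t 0
      subst ht; exact hTK.2 hK1
    · exact hTK.2 h1θK
  obtain ⟨p₁, hp₁K, hp₁box, hp₁min⟩ := exists_isMinOn_box_mem P TK γ hγK lo₁ hi₁ hlo₁K hhi₁K hle₁
  obtain ⟨p₂, hp₂K, hp₂box, hp₂min⟩ := exists_isMinOn_box_mem P TK γ hγK lo₂ hi₂ hlo₂K hhi₂K hle₂
  -- a point of a box with pinned `c̄`-coordinates, `|y_j| ≤ 1 - θm`, has the form `(C, x, y)`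
  have hshape : ∀ p : (Fin r ⊕ Fin 1) ⊕ Fin m → M, (∀ i, p (Sum.inl (Sum.inl i)) = C i) →
      p = Sum.elim (Sum.elim C ![p (Sum.inl (Sum.inr 0))]) (p ∘ Sum.inr) := by
    intro p hp
    funext c
    rcases c with (i | t) | j
    · exact hp i
    · have ht : t = 0 := Subsingleton.elim t 0
      subst ht; rfl
    · rfl
  have hnz : ∀ p : (Fin r ⊕ Fin 1) ⊕ Fin m → M, (∀ i, p (Sum.inl (Sum.inl i)) = C i) →
      (∀ j, |p (Sum.inr j)| ≤ 1 - θm) → p (Sum.inl (Sum.inr 0)) ≠ d →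
      MvPolynomial.aeval (pt p) P ≠ 0 := by
    intro p hp hy hx h0
    apply hx
    refine huniq' _ (p ∘ Sum.inr) (fun j => ?_) ?_
    · exact (hy j).trans_lt (by linarith)
    · rw [← hshape p hp]
      exact h0
  have hv₁ : MvPolynomial.aeval (pt p₁) P ≠ 0 := by
    refine hnz p₁ (fun i => le_antisymm (hp₁box (Sum.inl (Sum.inl i))).2 (hp₁box (Sum.inl (Sum.inl i))).1)
      (fun j => abs_le.2 ⟨(hp₁box (Sum.inr j)).1, (hp₁box (Sum.inr j)).2⟩) ?_
    have h := (hp₁box (Sum.inl (Sum.inr 0))).2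
    intro heq
    rw [heq] at h
    change d ≤ d / 2 at h
    linarith
  have hv₂ : MvPolynomial.aeval (pt p₂) P ≠ 0 := by
    refine hnz p₂ (fun i => le_antisymm (hp₂box (Sum.inl (Sum.inl i))).2 (hp₂box (Sum.inl (Sum.inl i))).1)
      (fun j => abs_le.2 ⟨(hp₂box (Sum.inr j)).1, (hp₂box (Sum.inr j)).2⟩) ?_
    have h := (hp₂box (Sum.inl (Sum.inr 0))).1
    intro heq
    rw [heq] at h
    change 2 * d ≤ d at h
    linarith
  set γ₀ : M := min |MvPolynomial.aeval (pt p₁) P| |MvPolynomial.aeval (pt p₂) P| with hγ₀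
  have hγ₀pos : 0 < γ₀ := lt_min (abs_pos.2 hv₁) (abs_pos.2 hv₂)
  have hγ₀K : γ₀ ∈ K := by
    rcases min_choice |MvPolynomial.aeval (pt p₁) P| |MvPolynomial.aeval (pt p₂) P| with h | h
    · rw [hγ₀, h]; exact hKabs _ (hFK p₁ fun c => hTK.1 (hp₁K c))
    · rw [hγ₀, h]; exact hKabs _ (hFK p₂ fun c => hTK.1 (hp₂K c))
  -- the key property of `γ₀`: small values of `|F|` on `[0,1] × A` only near `d`
  have hnear : ∀ (x : M) (y : Fin m → M), 0 ≤ x → x ≤ 1 → (∀ j, |y j| ≤ 1 - θm) →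
      |MvPolynomial.aeval (pt (Sum.elim (Sum.elim C ![x]) y)) P| < γ₀ → d / 2 < x ∧ x < 2 * d := by
    intro x y hx0 hx1 hy hlt
    by_contra hcon
    rw [not_and_or, not_lt, not_lt] at hcon
    rcases hcon with h | h
    · have hbox : ∀ c, lo₁ c ≤ (Sum.elim (Sum.elim C ![x]) y : (Fin r ⊕ Fin 1) ⊕ Fin m → M) c ∧
          (Sum.elim (Sum.elim C ![x]) y : (Fin r ⊕ Fin 1) ⊕ Fin m → M) c ≤ hi₁ c := by
        rintro ((i | t) | j)
        · exact ⟨le_rfl, le_rfl⟩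
        · have ht : t = 0 := Subsingleton.elim t 0
          subst ht; exact ⟨hx0, h⟩
        · exact ⟨(abs_le.1 (hy j)).1, (abs_le.1 (hy j)).2⟩
      have hmin := hp₁min _ hbox
      have : γ₀ ≤ |MvPolynomial.aeval (pt p₁) P| := min_le_left _ _
      exact not_lt.2 (this.trans hmin) hlt
    · have hbox : ∀ c, lo₂ c ≤ (Sum.elim (Sum.elim C ![x]) y : (Fin r ⊕ Fin 1) ⊕ Fin m → M) c ∧
          (Sum.elim (Sum.elim C ![x]) y : (Fin r ⊕ Fin 1) ⊕ Fin m → M) c ≤ hi₂ c := by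
        rintro ((i | t) | j)
        · exact ⟨le_rfl, le_rfl⟩
        · have ht : t = 0 := Subsingleton.elim t 0
          subst ht; exact ⟨h, hx1⟩
        · exact ⟨(abs_le.1 (hy j)).1, (abs_le.1 (hy j)).2⟩
      have hmin := hp₂min _ hbox
      have : γ₀ ≤ |MvPolynomial.aeval (pt p₂) P| := min_le_right _ _
      exact not_lt.2 (this.trans hmin) hlt
  -- Step 8: `η = c₁^{2N'} < γ₀`
  obtain ⟨N', hN'0, hN'⟩ := exists_pow_lt_of_inI hainf hcoi hγ₀K hγ₀pos (hCI i₁)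
  set η : M := C i₁ ^ (2 * N') with hη
  have hηabs : η = |C i₁| ^ (2 * N') := by rw [hη, pow_mul, pow_mul, ← sq_abs]
  have hηpos : 0 < η := by rw [hηabs]; exact pow_pos hc₁pos _
  have hηγ₀ : η < γ₀ := by
    rw [hηabs]
    exact (pow_le_pow_of_le_one (abs_nonneg _) hc₁lt.le (by omega)).trans_lt hN'
  have hηK : η ∈ K := hKpow _ (hCK i₁) _
  -- Step 9: `t₀ ∈ I ∩ K`, the order `λ`, the Taylor data in `k`
  set t₀ : M := 2 * ((∑ i, |C i|) + d + ∑ j, |β j - β₀ j|) with ht₀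
  have hS₁ : 0 ≤ ∑ i, |C i| := Finset.sum_nonneg fun i _ => abs_nonneg _
  have hS₂ : 0 ≤ ∑ j, |β j - β₀ j| := Finset.sum_nonneg fun j _ => abs_nonneg _
  have ht₀pos : 0 < t₀ := by rw [ht₀]; linarith
  have ht₀I : ∃ q : ℕ, |t₀| ^ (q + 1) ≤ a := by
    have hsum : ∃ q : ℕ, (abs ((∑ i, |C i|) + d + ∑ j, |β j - β₀ j|)) ^ (q + 1) ≤ a := by
      refine inI_add ha hainf (inI_add ha hainf ?_ hdI) ?_
      · refine inI_sum ha hainf _ _ fun i _ => ?_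
        rw [abs_abs]; exact hCI i
      · refine inI_sum ha hainf _ _ fun j _ => ?_
        rw [abs_abs]; exact hβ₀I j
    have h := inI_mul_inR ha hsum (inR_natCast hainf 2)
    rw [ht₀, mul_comm]
    exact_mod_cast h
  have ht₀K : t₀ ∈ K := by
    rw [ht₀]
    refine hKmul _ (hKnat 2) _ (hKadd _ (hKadd _ ?_ _ hdK) _ ?_)
    · exact Finset.sum_induction _ (· ∈ K) (fun a b ha hb => hKadd _ ha _ hb) hK0
        (fun i _ => hKabs _ (hCK i))
    · exact Finset.sum_induction _ (· ∈ K) (fun a b ha hb => hKadd _ ha _ hb) hK0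
        (fun j _ => hKabs _ (hKsub _ (hβ j).1 _ (hkK (hβ₀k j))))
  -- distances to `ω = (0̄, 0, β⁰)` are `< t₀`
  have hCt₀ : ∀ i, |C i| < t₀ := fun i => by
    have h : |C i| ≤ ∑ i, |C i| := Finset.single_le_sum (fun i _ => abs_nonneg (C i)) (Finset.mem_univ i)
    rw [ht₀]; linarith
  have hdt₀ : |d| < t₀ := by
    rw [abs_of_pos hd, ht₀]; linarith
  have hβt₀ : ∀ j, |β j - β₀ j| < t₀ := fun j => by
    have h : |β j - β₀ j| ≤ ∑ j, |β j - β₀ j| :=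
      Finset.single_le_sum (fun j _ => abs_nonneg (β j - β₀ j)) (Finset.mem_univ j)
    rw [ht₀]; linarith
  -- the order `λ`: `t₀^λ < η`
  obtain ⟨lam, hlam0, hlam⟩ := exists_pow_lt_of_inI hainf hcoi hηK hηpos ht₀I
  rw [abs_of_pos ht₀pos] at hlam
  -- Taylor data at `ω = (0̄, 0, β⁰)`, in `k`
  let ω : (Fin r ⊕ Fin 1) ⊕ Fin m → M := Sum.elim (Sum.elim (fun _ => 0) ![0]) β₀
  have hωk : ∀ c, ω c ∈ Tk := by
    rintro ((i | t) | j)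
    · exact hTk.2 hk0
    · have ht : t = 0 := Subsingleton.elim t 0
      subst ht; exact hTk.2 hk0
    · exact hTk.2 (hβ₀k j)
  have hγk' : ∀ i, γ i ∈ Tk := fun i => hTk.2 (hγk i)
  obtain ⟨r₀, c, B, hr₀k, hck, hBk, hr₀, hB, htaylor⟩ := exists_taylor_mem P lam Tk γ hγk' ω hωk
  replace hr₀k : r₀ ∈ k := hTk.1 hr₀k
  replace hBk : B ∈ k := hTk.1 hBk
  replace hck : ∀ ki, c ki ∈ k := fun ki => hTk.1 (hck ki)
  have ht₀r₀ : t₀ < r₀ := lt_of_inI_of_mem ha hainf hkR hkinv hr₀k hr₀ ht₀I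
  -- the key inequality `2 B t₀^{λ+1} < η`
  have hkey : 2 * B * t₀ ^ (lam + 1) < η := by
    have h1 : ∃ q : ℕ, |t₀ * B * 2| ^ (q + 1) ≤ a :=
      inI_mul_inR ha (inI_mul_inR ha ht₀I (hkR _ hBk)) (inR_natCast hainf 2)
    obtain ⟨q, hq⟩ := h1
    have h2 := natCast_mul_abs_lt_one_of_pow_le hainf hq 1
    rw [Nat.cast_one, one_mul] at h2
    have h3 : t₀ * B * 2 < 1 := (le_abs_self _).trans_lt h2
    have h4 : 0 ≤ t₀ ^ lam := pow_nonneg ht₀pos.le _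
    calc 2 * B * t₀ ^ (lam + 1) = (t₀ * B * 2) * t₀ ^ lam := by ring
      _ ≤ 1 * t₀ ^ lam := by gcongr
      _ = t₀ ^ lam := one_mul _
      _ < η := hlam
  -- distances from `(C̄, d, β)` to `ω` are `< t₀`
  have hdist : ∀ c', |(Sum.elim (Sum.elim C ![d]) β : (Fin r ⊕ Fin 1) ⊕ Fin m → M) c' - ω c'| < t₀ := by
    rintro ((i | t) | j)
    · show |C i - 0| < t₀
      rw [sub_zero]; exact hCt₀ i
    · have ht : t = 0 := Subsingleton.elim t 0
      subst ht
      show |d - 0| < t₀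
      rw [sub_zero]; exact hdt₀
    · exact hβt₀ j
  -- the Taylor polynomial at `(C, d, β)` is small
  have hρ : 2 * |∑ ki, c ki * ∏ l, ((Sum.elim (Sum.elim C ![d]) β : (Fin r ⊕ Fin 1) ⊕ Fin m → M) (ki.2 l) -
      ω (ki.2 l))| < η := by
    have h := htaylor t₀ ht₀pos ht₀r₀ (Sum.elim (Sum.elim C ![d]) β) hdist
    have h0 : MvPolynomial.aeval (pt (Sum.elim (Sum.elim C ![d]) β)) P = 0 := hzero'
    rw [show MvPolynomial.aeval (Sum.elim (Sum.elim γ (Sum.elim (Sum.elim C ![d]) β))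
        (Sum.elim (fun i => EFun.e (γ i)) (Sum.elim
          (fun i => EFun.e ((Sum.elim (Sum.elim C ![d]) β : (Fin r ⊕ Fin 1) ⊕ Fin m → M) (Sum.inl i)))
          (fun j => if (Sum.elim (Sum.elim C ![d]) β : (Fin r ⊕ Fin 1) ⊕ Fin m → M) (Sum.inr j) ^ 2 = 1 then 1
            else EFun.e ((Sum.elim (Sum.elim C ![d]) β : (Fin r ⊕ Fin 1) ⊕ Fin m → M) (Sum.inr j) /
              (1 - (Sum.elim (Sum.elim C ![d]) β : (Fin r ⊕ Fin 1) ⊕ Fin m → M) (Sum.inr j) ^ 2)))))) P =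
        MvPolynomial.aeval (pt (Sum.elim (Sum.elim C ![d]) β)) P from rfl, h0, zero_sub, abs_neg] at h
    calc 2 * |∑ ki, c ki * ∏ l, ((Sum.elim (Sum.elim C ![d]) β : (Fin r ⊕ Fin 1) ⊕ Fin m → M) (ki.2 l) - ω (ki.2 l))|
        ≤ 2 * (B * t₀ ^ (lam + 1)) := by gcongr
      _ = 2 * B * t₀ ^ (lam + 1) := by ring
      _ < η := hkey
  -- Step 10: the transfer to the real closed field `k* = k(C̄)^{alg} ∩ M`
  have hks : ∀ {z : M}, z ∈ k ∪ Set.range C →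
      z ∈ algebraicClosure (Subfield.closure (k ∪ Set.range C)) M := fun hz => mem_kstar_of_mem hz
  have hωks : ∀ c', ω c' ∈ algebraicClosure (Subfield.closure (k ∪ Set.range C)) M := by
    rintro ((i | s) | j)
    · exact hks (Or.inl hk0)
    · have hs : s = 0 := Subsingleton.elim s 0
      subst hs
      exact hks (Or.inl hk0)
    · exact hks (Or.inl (hβ₀k j))
  have hηks : η ∈ algebraicClosure (Subfield.closure (k ∪ Set.range C)) M := by
    rw [hη]; exact pow_mem (hks (Or.inr ⟨i₁, rfl⟩)) _
  have hθks : θm ∈ algebraicClosure (Subfield.closure (k ∪ Set.range C)) M := by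
    rw [hθm]; exact pow_mem (hks (Or.inr ⟨i₁, rfl⟩)) _
  have hβabs : ∀ j, |β j| ≤ 1 - θm := fun j => by linarith [hθmβ j]
  obtain ⟨α, hαks, hα1, hα2⟩ := exists_mem_algebraicClosure_near k C
    (fun p => MvPolynomial.aeval (pt p) P) c ω d η θm r₀ B t₀ β (fun ki => hks (Or.inl (hck ki))) hωks
    hηks hθks (hks (Or.inl hr₀k)) (hks (Or.inl hBk)) htaylor
    (fun x y h0 h1 hy hlt => hnear x y h0 h1 hy (hlt.trans hηγ₀)) hd.le (by linarith) hβabs hρ hdist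
    ht₀pos ht₀r₀ hkey
  have hαpos : 0 < α := by linarith
  refine ⟨α, exists_polynomial_of_mem_algebraicClosure (k ∪ Set.range C) hαks, 2, ?_, ?_⟩
  · rw [abs_of_pos (div_pos hαpos hd), mul_div_assoc', le_div_iff₀ hd]
    push_cast
    linarith
  · rw [abs_of_pos (div_pos hαpos hd), div_le_iff₀ hd]
    push_cast
    linarith

end Endgame

end SurjectivityStep

/-! ### The surjectivity step, the valuation inequality for `T_e`, and Wilkie's theorem from the First Main Theorem and `S₁` -/

section Main

open RealExpModel SurjectivityStep AbsoluteInequality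

/-- **The surjectivity step of den Besten's Theorem 7.1.22 for `T_e`** (the hypothesis `hsurj` of
`AbsoluteInequality.absolute_of_surjectivity`, den Besten 2016, pp. 86–89; Wilkie 1996, §10): let
`M ⊨ T_exp`, `K, k ⊆ M` definably closed in `L_e`, `k ⊆ K`, `a ∈ K` a positive infinitesimal
scale with `K` coinitial in the powers of `a` above `0`, `k ⊆ R_a` with the splitting
`K ∩ R_a = k + I_a`, `C̄ ∈ (I_a ∩ K)ʳ` with `K ⊆ Dcl_e(k ∪ C̄)`, and `d ∈ I_a ∩ K` non-zero.  Then
some `α`, algebraic over `k[C̄]`, has the same value as `d`: `α / d` is a valuation unit.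
Proof: `exists_smooth_data` (the `k`-definable function with `f(c̄) = d` and its smooth
presentation `F(c̄, d, β) = 0` by `S₂`, `Wilkie1996SmoothnessS2.lean`) and `endgame` (extreme
values on the two boxes, Taylor approximation at the `k`-rational point `(0̄, 0, β⁰)`, transfer to
the real closed field `k*`), after replacing `d` by `|d|`.
[cite: DenBesten2016, Theorem 7.1.22 (pp. 86–89)] [cite: WilkieJAMS1996, §10] -/
theorem SurjectivityStep.surjectivity_step (hMC : rexpTheory.IsModelComplete)
    (M : Language.Theory.ModelType.{0, 0, 0} realExpTheory) (K k : Set M)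
    (hKcl : definableClosure Language.orderedERing K = K)
    (hkcl : definableClosure Language.orderedERing k = k) (hkK : k ⊆ K)
    (a : M) (_haK : a ∈ K) (ha : 0 < a) (hainf : ∀ n : ℕ, (n : M) * a < 1)
    (hcoi : ∀ b ∈ K, 0 < b → ∃ q : ℕ, a ^ q < b)
    (hkR : ∀ b ∈ k, ∀ q : ℕ, |b| ^ q * a < 1)
    (_hcof : ∀ b ∈ K, (∀ q : ℕ, |b| ^ q * a < 1) → ∃ b' ∈ k, b < b')
    (hsplit : ∀ b ∈ K, (∀ q : ℕ, |b| ^ q * a < 1) → ∃ b₀ ∈ k, ∃ q : ℕ, |b - b₀| ^ (q + 1) ≤ a)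
    (r : ℕ) (C : Fin r → M) (hCK : ∀ i, C i ∈ K) (hCI : ∀ i, ∃ q : ℕ, |C i| ^ (q + 1) ≤ a)
    (hKgen : K ⊆ definableClosure Language.orderedERing (k ∪ Set.range C))
    (d : M) (hdK : d ∈ K) (hd0 : d ≠ 0) (hdI : ∃ q : ℕ, |d| ^ (q + 1) ≤ a) :
    ∃ α : M, (∃ p : Polynomial M, p ≠ 0 ∧
      (∀ n, p.coeff n ∈ Subring.closure (k ∪ Set.range C)) ∧ p.eval α = 0) ∧
      IsVUnit (α / d) := by
  classical
  -- Step 0: the conclusion only depends on `|d|`, so `0 < d` without loss of generality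
  suffices h : ∀ d : M, d ∈ K → 0 < d → (∃ q : ℕ, |d| ^ (q + 1) ≤ a) →
      ∃ α : M, (∃ p : Polynomial M, p ≠ 0 ∧
        (∀ n, p.coeff n ∈ Subring.closure (k ∪ Set.range C)) ∧ p.eval α = 0) ∧
        IsVUnit (α / d) by
    have hdabs : |d| ∈ K := by
      rcases abs_choice d with h' | h'
      · rw [h']; exact hdK
      · rw [h', ← hKcl]
        exact OrderedFieldExpansion.neg_mem_definableClosure
          (LHom.sumInl : Language.orderedRing →ᴸ Language.orderedERing)
          (subset_definableClosure K hdK)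
    obtain ⟨α, hα, hu⟩ := h |d| hdabs (abs_pos.2 hd0) (by rwa [abs_abs])
    refine ⟨α, hα, ?_⟩
    rw [← isVUnit_abs] at hu ⊢
    rw [abs_div, abs_abs] at hu
    rwa [abs_div]
  intro d hdK hd hdI
  obtain ⟨n₀, m, γ, P, β, hγk, hβ, hzero, huniq⟩ :=
    exists_smooth_data hMC K k hKcl hkK C hCK d hdK (hKgen hdK)
  exact endgame hMC K k hKcl hkcl hkK a ha hainf hcoi hkR hsplit C hCK hCI hKgen d hdK hd hdI γ hγk
    P β hβ hzero huniq

/-- **The absolute valuation inequality for `T_e`, from the First Main Theorem and `S₁`**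
(den Besten 2016, Theorem 7.1.22 for `T = T_e`: for `M ⊨ T_exp` and `c̄ ∈ Mᵐ`, any `m + 1`
non-zero elements of `Dcl_e(c̄)` are multiplicatively dependent modulo the valuation units;
`AbsoluteInequality.absolute_of_surjectivity` with its hypothesis `hsurj` discharged by
`SurjectivityStep.surjectivity_step`).  The remaining hypotheses are the First Main Theorem
(`hMC`, model completeness of `T_{exp↾}`) and the polynomial bounds `S₁` for `T_e` in all models
(`hS1`). [cite: DenBesten2016, Theorems 7.1.22 and 7.2.1] [cite: WilkieJAMS1996, §10] -/
theorem RealExpModel.exists_isVUnit_prod_zpow_of_S1 (hMC : rexpTheory.IsModelComplete)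
    (hS1 : ∀ K : Language.Theory.ModelType.{0, 0, 0} realExpTheory,
      IsPolynomiallyBounded Language.orderedERing K)
    (M : Language.Theory.ModelType.{0, 0, 0} realExpTheory) (m : ℕ) (c : Fin m → M)
    (x : Fin (m + 1) → M) (hx : ∀ j, x j ∈ definableClosure Language.orderedERing (Set.range c))
    (hx0 : ∀ j, x j ≠ 0) : ∃ e : Fin (m + 1) → ℤ, e ≠ 0 ∧ IsVUnit (∏ j, x j ^ e j) :=
  absolute_of_surjectivity hMC hS1 (surjectivity_step hMC) M m c x hx hx0

/-- **The last theorem of Wilkie 1996 from the First Main Theorem and `S₁` for `T_e`**: the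
boundedness of the non-singular zeros of exponential-polynomial systems in the models of `T_exp`
(`Wilkie1996_expPolynomialPoints_bounded`) follows from model completeness of `T_{exp↾}` and the
polynomial bounds for `T_e`, everything else (Lemma 9.3, the induction of §9, the valuation
inequality with its surjectivity step, smoothness `S₂`) being proved in the tree.
[cite: WilkieJAMS1996, §§9–11] [cite: DenBesten2016, Theorems 7.1.22–7.1.23, 7.2.1 and Lemma 7.2.4] -/
theorem Wilkie1996_expPolynomialPoints_bounded_of_S1 (hMC : rexpTheory.IsModelComplete)
    (hS1 : ∀ K : Language.Theory.ModelType.{0, 0, 0} realExpTheory,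
      IsPolynomiallyBounded Language.orderedERing K) :
    Wilkie1996_expPolynomialPoints_bounded :=
  Wilkie1996_expPolynomialPoints_bounded_of_surjectivity hMC hS1 (surjectivity_step hMC)

/-- **Wilkie's theorem (model completeness of `ℝ_exp`) from the First Main Theorem and `S₁` for
`T_e`.** [cite: WilkieJAMS1996, Second Main Theorem and §§9–11] [cite: DenBesten2016, §6.2 and §7.2] -/
theorem wilkie_isModelComplete_of_S1 (hMC : rexpTheory.IsModelComplete)
    (hS1 : ∀ K : Language.Theory.ModelType.{0, 0, 0} realExpTheory,
      IsPolynomiallyBounded Language.orderedERing K) :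
    wilkie_isModelComplete :=
  wilkie_isModelComplete_of_surjectivity hMC hS1 (surjectivity_step hMC)

/-- **`Wilkie1996_realExp_modelsExistentiallyClosed` (the models of `T_exp` are existentially
closed in each other) from the First Main Theorem and `S₁` for `T_e`.**
[cite: WilkieJAMS1996, §9, p. 1083] [cite: DenBesten2016, §6.2 and §7.2] -/
theorem Wilkie1996_realExp_modelsExistentiallyClosed_of_S1 (hMC : rexpTheory.IsModelComplete)
    (hS1 : ∀ K : Language.Theory.ModelType.{0, 0, 0} realExpTheory,
      IsPolynomiallyBounded Language.orderedERing K) :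
    Wilkie1996_realExp_modelsExistentiallyClosed :=
  Wilkie1996_realExp_modelsExistentiallyClosed_of_surjectivity hMC hS1 (surjectivity_step hMC)

/-- **`Wilkie1996_expPolynomial_transfer` from the First Main Theorem and `S₁` for `T_e`.**
[cite: WilkieJAMS1996, Second Main Theorem and §§9–11] -/
theorem Wilkie1996_expPolynomial_transfer_of_S1 (hMC : rexpTheory.IsModelComplete)
    (hS1 : ∀ K : Language.Theory.ModelType.{0, 0, 0} realExpTheory,
      IsPolynomiallyBounded Language.orderedERing K) :
    Wilkie1996_expPolynomial_transfer :=
  Wilkie1996_expPolynomial_transfer_of_surjectivity hMC hS1 (surjectivity_step hMC)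

/-- **O-minimality of `ℝ_exp` from the First Main Theorem and `S₁` for `T_e`** (via Wilkie's
theorem and Khovanskii finiteness). [cite: WilkieJAMS1996, §1] -/
theorem wilkie_isOMinimal_of_S1 (hMC : rexpTheory.IsModelComplete)
    (hS1 : ∀ K : Language.Theory.ModelType.{0, 0, 0} realExpTheory,
      IsPolynomiallyBounded Language.orderedERing K) :
    wilkie_isOMinimal :=
  wilkie_isOMinimal_of_surjectivity hMC hS1 (surjectivity_step hMC)

end Main

end Literature.ModelTheory.ExponentialFields
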